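import Literature.AlgebraicGeometry.HodgeTheory.UnitaryTwoOneTimesCMCurveCubeCodimThreeStructure
import Literature.AlgebraicGeometry.HodgeTheory.CMCurveCubePointClassDescent
import HarnessLib

/-!
# `B³(T × E³) ⊆ D³ + B² ⌣ B¹` for the sixfold `E³ × T`, `T` a `(2,1)`-threefold, `E` a CM elliptic curve
# (Moonen–Zarhin 1999 Thm. 0.2 (1); TABLE X row 21, codimension three)

Family `hodge`, layer `Literature/AlgebraicGeometry/HodgeTheory`. Written for the cell `pub-hodgeav-hg6` (LADDER-HodgeAV row 2,
TABLE X row 21 `g6.E3xY3.(2,1)`, census programme γ2, brick γ2-D(ii), eng-2 g6; honest framing of that cell: HC / HC_AV / HC_CM NOT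
proved — THIS file is UNCONDITIONAL). Theorems only (no definition, no named fact, D-0026; nothing admitted).

## What is proved

* `powersetCard_three_classify` (with `sum_blockCount_eq_three`, `blockCount_le_two`, `mem_of_blockCount_eq_two`, `stdSubset_shape`) —
  the `3`-subsets of the six letters `Fin 3 × Fin 2` of `H¹(E³)` have slot shape `(1,1,1)` or are `{(a,0),(a,1),(b′,r)}`.
* **`mem_divisorClassesSpan_sup_span_cup_of_unitaryTwoOne_cmCurve_powThree_codimThree`** (and the `(E × E) × E`-spelled
  `mem_divisorClassesSpan_sup_span_cup_of_unitaryTwoOne_cmCurve_cube_codimThree`) — for `T` (here `Y`) a complex abelian threefold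
  with `dim_ℚ End⁰(T) = 2`, `φ ≫ φ = -d` (`d > 0`) of multiplicity `1` at `i√d` or at `-i√d` (`End⁰(T) = ℚ(√-d)` acting with
  multiplicities `(2,1)`), and `E` an elliptic curve with complex multiplication `χ ≫ χ = -d'` (`d' > 0`, any imaginary quadratic
  `ℚ(χ)`): EVERY rational `(3,3)`-class on `T × E³` lies in the `ℂ`-span of the products of divisor classes and of the products
  `a ⌣ b` of a rational `(2,2)`-class `a` and a rational `(1,1)`-class `b` — the exceptional Hodge classes of codimension three are
  generated by those of lower codimension (Moonen–Zarhin: the Hodge ring of `T × E^j` is generated by divisor classes and the Weil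
  classes pulled back from `T × E`). The Weil classes themselves are not identified here, and `D³ ≠ B³` is not asserted.

## Proof

`exists_decomp_codimThree_of_unitaryTwoOne_cmCurve_cube` gives `c = c_B + c_W`, `c_B ∈ D³`, `c_W` rational of type `(3,3)` in the
span of the `pr_T^* u ⌣ pr_S^* v`, `(u, v)` of types `((2,1),(1,2))` or `((1,2),(2,1))` (`S = E³`). Expanding `v` in typed words of the
letters `q_i^* ω`, `q_i^* ω̄` (`EllSlots.exists_typed_wordEval_eq`), `c_W` lies in the span of the `pr_T^* u ⌣ pr_S^*(g f)_w`. The Künneth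
projectors of `T × S` onto the blocks of the rational cup-monomial basis of `H³(S)` (`EllSlots.exists_cupMonomialBasis`) indexed by
the slot shapes (`powersetCard_three_classify`) are rational (`isRationalClass_kunneth_symm_apply`) and fix or kill each generator
according to the slot counts of its word (`blockCount_eq_slotCount_of_repr_cupPowOneAlt_ne_zero`), so `c_W = z + Σ_{a ≠ b′} z_{ab′}`
with each block rational and in the span of the generators of its shape. A `(2,1)`-block `z_{ab′}` is `A ⌣ pr_S^*(q_a^*e₀ ⌣ q_a^*e₁)`
with `A = Σ_j pr_T^* γ_j ⌣ pr_S^* q_{b′}^* e_j` of type `(2,2)` (word normal form `map_word_of_slotCounts_two_one`, type uniqueness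
`IsOfHodgeType.eq_zero_of_ne`), hence RATIONAL (`isRationalClass_of_sum_cup_slot_cup_pointClass`). The `(1,1,1)`-block `z`: its generators
are `pr_T^* u ⌣ pr_S^*(q_0^* ω^{ε₀} ⌣ q_1^* ω^{ε₁} ⌣ q_2^* ω^{ε₂})` with `ε` non-constant; for a pair of slots `a ≠ c` (third slot `b`)
the shears `x_a ↦ x_a + ψ(x_c)` of `E³` (`EllipticCurve.exists_powThree_shear`, `ψ = 𝟙, χ`, `χ^* ω = μ ω`, `χ^* ω̄ = μ̄ ω̄`, `μ ≠ μ̄`)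
satisfy `(𝟙 × shear)^* z - z = B_ψ ⌣ pr_S^*(q_c^*e₀ ⌣ q_c^*e₁)` with `B_𝟙 = κσ (P₀ - P₁)`, `B_χ = κσ (μ P₀ - μ̄ P₁)` rational `(2,2)`
(descent again), where `P_r` collects the generators with `ε_a = r ≠ ε_c`; so `P₀, P₁` are combinations of rational `(2,2)`-classes,
and the `(a,c)`-part of `z` is `σ (P₀ ⌣ C₀ + P₁ ⌣ C₁)` with the crosses `C_r = pr_S^*(q_a^* ω^r ⌣ q_c^* ω^{1-r})` combinations of rational
`(1,1)`-classes (complex multiplication, `EllipticCurve.slotLetters_cross_mem_span_rational_oneOne_of_not_hodgeEndTrivial`); the three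
`(a,c)`-parts add up to `2z`.

## Sources

* [MoonenZarhin1999LowDim] B. Moonen, Yu. Zarhin, Hodge classes on abelian varieties of low dimension, Math. Ann. 315 (1999) 711–733,
  Thm. 0.2 (1), §2 (2.1), (2.8), §5 (5.3), (5.11).
* [HatcherAT2002] A. Hatcher, *Algebraic Topology* (2002), §3.2 Prop. 3.10, Thm. 3.11, Thm. 3.16.
* [VoisinHodgeI2002] C. Voisin, *Hodge Theory and Complex Algebraic Geometry I* (2002), §7.1.1, §11.3.2 Thm. 11.38.
* [LangeBirkenhake1992] H. Lange, Ch. Birkenhake, *Complex Abelian Varieties* (1992), Thm. 4.2.1, §5.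
* [FultonYoungTableaux1997] W. Fulton, *Young Tableaux* (1997), §8.1.
-/

noncomputable section

open scoped TensorProduct
open CategoryTheory Module

namespace Literature.AlgebraicGeometry.HodgeTheory

open Literature.AlgebraicTopology.SingularHomology
open Literature.AlgebraicGeometry.Motives (IsSmoothProjective AbelianVariety bettiCohomology
  ofRatClassBaseChange)
open Literature.Barriers.HodgeConjecture
open Literature.AlgebraicGeometry.Motives.HodgeStructure
open Literature.AlgebraicGeometry.ComplexMultiplication
open Literature.RepresentationTheory.GeneralLinear
open Literature.NumberTheory.DiophantineGeometry

/-- The two elements of `Fin 2`. [folklore] -/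
private theorem fin2_eq_zero_or_one_cc (r : Fin 2) : r = 0 ∨ r = 1 := by
  fin_cases r <;> simp

/-! ### §4 Combinatorics of the `3`-subsets of the six letters of `E³` -/

section Classify

/-- For a `3`-subset `s` of the six letters `Fin 3 × Fin 2` of `E³`: the numbers of letters of `s` in the three slots add up to `3`.
[cite: FultonYoungTableaux1997, §8.1] -/
theorem sum_blockCount_eq_three (s : Set.powersetCard (Fin (3 * 2)) 3) :
    ∑ a : Fin 3, (s.val.filter fun j => (finProdFinEquiv.symm j).1 = a).card = 3 := by
  classical
  exact (Finset.card_eq_sum_card_fiberwise (s := s.val) (t := Finset.univ)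
    (f := fun j : Fin (3 * 2) => (finProdFinEquiv.symm j).1) (fun _ _ => Finset.mem_univ _)).symm.trans s.prop

/-- … and each slot carries at most `2` letters of `s`. [cite: FultonYoungTableaux1997, §8.1] -/
theorem blockCount_le_two (s : Set.powersetCard (Fin (3 * 2)) 3) (a : Fin 3) :
    (s.val.filter fun j => (finProdFinEquiv.symm j).1 = a).card ≤ 2 := by
  classical
  have hsub : (s.val.filter fun j => (finProdFinEquiv.symm j).1 = a) ⊆
      Finset.univ.image (fun r : Fin 2 => finProdFinEquiv (a, r)) := by
    intro j hj
    rw [Finset.mem_filter] at hj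
    refine Finset.mem_image.2 ⟨(finProdFinEquiv.symm j).2, Finset.mem_univ _, ?_⟩
    rw [← hj.2, Prod.mk.eta, Equiv.apply_symm_apply]
  refine (Finset.card_le_card hsub).trans ?_
  refine Finset.card_image_le.trans ?_
  rw [Finset.card_univ, Fintype.card_fin]

/-- If slot `a` carries `2` letters of `s`, both letters `(a,0)`, `(a,1)` lie in `s`. [cite: FultonYoungTableaux1997, §8.1] -/
theorem mem_of_blockCount_eq_two (s : Set.powersetCard (Fin (3 * 2)) 3) {a : Fin 3}
    (ha : (s.val.filter fun j => (finProdFinEquiv.symm j).1 = a).card = 2) (r : Fin 2) : finProdFinEquiv (a, r) ∈ s.val := by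
  classical
  have hsub : (s.val.filter fun j => (finProdFinEquiv.symm j).1 = a) ⊆
      Finset.univ.image (fun r : Fin 2 => finProdFinEquiv (a, r)) := by
    intro j hj
    rw [Finset.mem_filter] at hj
    refine Finset.mem_image.2 ⟨(finProdFinEquiv.symm j).2, Finset.mem_univ _, ?_⟩
    rw [← hj.2, Prod.mk.eta, Equiv.apply_symm_apply]
  have hcard : (Finset.univ.image (fun r : Fin 2 => finProdFinEquiv (a, r))).card ≤
      (s.val.filter fun j => (finProdFinEquiv.symm j).1 = a).card := by
    rw [ha]; exact Finset.card_image_le.trans (by rw [Finset.card_univ, Fintype.card_fin])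
  have heq := Finset.eq_of_subset_of_card_le hsub hcard
  have hmem : finProdFinEquiv (a, r) ∈ Finset.univ.image (fun r : Fin 2 => finProdFinEquiv (a, r)) :=
    Finset.mem_image.2 ⟨r, Finset.mem_univ _, rfl⟩
  rw [← heq, Finset.mem_filter] at hmem
  exact hmem.1

/-- **Classification of the `3`-subsets of the letters of `E³`**: either one letter in each slot, or `s = {(a,0),(a,1),(b′,r)}` for slots
`a ≠ b′`. [cite: FultonYoungTableaux1997, §8.1] [cite: MoonenZarhin1999LowDim, §5] -/
theorem powersetCard_three_classify (s : Set.powersetCard (Fin (3 * 2)) 3) :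
    (∀ a : Fin 3, (s.val.filter fun j => (finProdFinEquiv.symm j).1 = a).card = 1) ∨
      ∃ (a b' : Fin 3) (hab : a ≠ b') (r : Fin 2), s = Set.powersetCard.ofCard (card_image_stdWord_two_one hab r) := by
  classical
  by_cases hall : ∀ a : Fin 3, (s.val.filter fun j => (finProdFinEquiv.symm j).1 = a).card = 1
  · exact Or.inl hall
  right
  push Not at hall
  obtain ⟨a₀, ha₀⟩ := hall
  have hsum := sum_blockCount_eq_three s
  have hle := blockCount_le_two s
  rw [Fin.sum_univ_three] at hsum
  -- some slot `a` carries two letters and some other slot `b′` one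
  have hex : ∃ a b' : Fin 3, a ≠ b' ∧ (s.val.filter fun j => (finProdFinEquiv.symm j).1 = a).card = 2 ∧
      (s.val.filter fun j => (finProdFinEquiv.symm j).1 = b').card = 1 := by
    have h0 := hle 0; have h1 := hle 1; have h2 := hle 2
    have h3 : ∀ i : Fin 3, i = 0 ∨ i = 1 ∨ i = 2 := by intro i; fin_cases i <;> simp
    rcases h3 a₀ with rfl | rfl | rfl
    · by_cases h20 : (s.val.filter fun j => (finProdFinEquiv.symm j).1 = (0 : Fin 3)).card = 2
      · by_cases h11 : (s.val.filter fun j => (finProdFinEquiv.symm j).1 = (1 : Fin 3)).card = 1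
        · exact ⟨0, 1, by decide, h20, h11⟩
        · exact ⟨0, 2, by decide, h20, by omega⟩
      · by_cases h21 : (s.val.filter fun j => (finProdFinEquiv.symm j).1 = (1 : Fin 3)).card = 2
        · exact ⟨1, 2, by decide, h21, by omega⟩
        · exact ⟨2, 1, by decide, by omega, by omega⟩
    · by_cases h21 : (s.val.filter fun j => (finProdFinEquiv.symm j).1 = (1 : Fin 3)).card = 2
      · by_cases h10 : (s.val.filter fun j => (finProdFinEquiv.symm j).1 = (0 : Fin 3)).card = 1
        · exact ⟨1, 0, by decide, h21, h10⟩
        · exact ⟨1, 2, by decide, h21, by omega⟩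
      · by_cases h20 : (s.val.filter fun j => (finProdFinEquiv.symm j).1 = (0 : Fin 3)).card = 2
        · exact ⟨0, 2, by decide, h20, by omega⟩
        · exact ⟨2, 0, by decide, by omega, by omega⟩
    · by_cases h22 : (s.val.filter fun j => (finProdFinEquiv.symm j).1 = (2 : Fin 3)).card = 2
      · by_cases h10 : (s.val.filter fun j => (finProdFinEquiv.symm j).1 = (0 : Fin 3)).card = 1
        · exact ⟨2, 0, by decide, h22, h10⟩
        · exact ⟨2, 1, by decide, h22, by omega⟩
      · by_cases h20 : (s.val.filter fun j => (finProdFinEquiv.symm j).1 = (0 : Fin 3)).card = 2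
        · exact ⟨0, 1, by decide, h20, by omega⟩
        · exact ⟨1, 0, by decide, by omega, by omega⟩
  obtain ⟨a, b', hab, ha2, hb1⟩ := hex
  obtain ⟨j₀, hj₀⟩ := Finset.card_eq_one.1 hb1
  have hj₀mem : j₀ ∈ s.val ∧ (finProdFinEquiv.symm j₀).1 = b' := by
    have h : j₀ ∈ s.val.filter fun j => (finProdFinEquiv.symm j).1 = b' := by rw [hj₀]; exact Finset.mem_singleton_self _
    exact Finset.mem_filter.1 h
  set r := (finProdFinEquiv.symm j₀).2 with hr
  have hj₀eq : finProdFinEquiv (b', r) = j₀ := by rw [← hj₀mem.2, hr, Prod.mk.eta, Equiv.apply_symm_apply]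
  refine ⟨a, b', hab, r, ?_⟩
  apply Subtype.ext
  symm
  apply Finset.eq_of_subset_of_card_le
  · intro j hj
    change j ∈ Finset.univ.image _ at hj
    obtain ⟨t, -, rfl⟩ := Finset.mem_image.1 hj
    have h3 : t = 0 ∨ t = 1 ∨ t = 2 := by fin_cases t <;> simp
    rcases h3 with rfl | rfl | rfl
    · exact mem_of_blockCount_eq_two s ha2 0
    · exact mem_of_blockCount_eq_two s ha2 1
    · change finProdFinEquiv (b', r) ∈ s.val
      rw [hj₀eq]; exact hj₀mem.1
  · rw [s.prop]
    exact (card_image_stdWord_two_one hab r).ge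

/-- A standard subset of shape `(2,1)` is not of shape `(1,1,1)`, and determines its slots. [cite: FultonYoungTableaux1997, §8.1] -/
theorem stdSubset_shape {a b' : Fin 3} (hab : a ≠ b') (r : Fin 2) :
    ¬ (∀ c : Fin 3, ((Set.powersetCard.ofCard (card_image_stdWord_two_one hab r) : Set.powersetCard (Fin (3 * 2)) 3).val.filter
        fun j => (finProdFinEquiv.symm j).1 = c).card = 1) ∧
    ∀ (a'' b'' : Fin 3) (hab'' : a'' ≠ b'') (r'' : Fin 2),
      (Set.powersetCard.ofCard (card_image_stdWord_two_one hab r) : Set.powersetCard (Fin (3 * 2)) 3) =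
        Set.powersetCard.ofCard (card_image_stdWord_two_one hab'' r'') → a'' = a ∧ b'' = b' := by
  classical
  have hcount := blockCount_std_two_one hab r
  refine ⟨fun h => ?_, fun a'' b'' hab'' r'' heq => ?_⟩
  · have h2 := h a
    change ((Finset.univ.image (finProdFinEquiv ∘ (![(a, 0), (a, 1), (b', r)] : Fin 3 → Fin 3 × Fin 2))).filter
      fun j => (finProdFinEquiv.symm j).1 = a).card = 1 at h2
    rw [hcount a, if_pos rfl] at h2
    exact absurd h2 (by decide)
  · have hcount'' := blockCount_std_two_one hab'' r''
    have hval : ∀ c, ((Finset.univ.image (finProdFinEquiv ∘ (![(a, 0), (a, 1), (b', r)] : Fin 3 → Fin 3 × Fin 2))).filter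
        fun j => (finProdFinEquiv.symm j).1 = c).card =
        ((Finset.univ.image (finProdFinEquiv ∘ (![(a'', 0), (a'', 1), (b'', r'')] : Fin 3 → Fin 3 × Fin 2))).filter
        fun j => (finProdFinEquiv.symm j).1 = c).card := fun c => by
      have := congrArg (fun t : Set.powersetCard (Fin (3 * 2)) 3 => (t.val.filter fun j => (finProdFinEquiv.symm j).1 = c).card) heq
      exact this
    have ha : a'' = a := by
      have h := hval a''
      rw [hcount a'', hcount'' a'', if_pos rfl] at h
      by_contra hne
      rw [if_neg hne] at h
      split_ifs at h; omega
    have hb : b'' = b' := by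
      have h := hval b''
      rw [hcount b'', hcount'' b'', if_neg (Ne.symm hab''), if_pos rfl] at h
      by_contra hne
      rw [if_neg hne] at h
      split_ifs at h; omega
    exact ⟨ha, hb⟩

end Classify

/-! ### §5 The theorem -/

section Main

variable {Y E : AbelianVariety ℂ}

set_option maxHeartbeats 3200000 in
open scoped Classical in
/-- **`B³(T × E³) ⊆ D³(T × E³) + B²(T × E³) ⌣ B¹(T × E³)` — Moonen–Zarhin's Thm. 0.2 (1) mechanism for the SIXFOLD `E³ × T` (TABLE X row 21),
codimension three: the exceptional Hodge classes are products of Hodge classes of lower codimension, a THEOREM** (`E³ = E.powSucc 2`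
spelling). Let `T` (here `Y`) be a complex abelian threefold with `dim_ℚ End⁰(T) = 2`, `φ ≫ φ = -d` (`d > 0`) of multiplicity `1` at `i√d`
or at `-i√d`, and `E` an elliptic curve with complex multiplication `χ ≫ χ = -d'` (`d' > 0`). Then every rational `(3,3)`-class on
`T × E³` lies in the `ℂ`-span of the products of divisor classes and of the products `a ⌣ b` of a rational `(2,2)`-class `a` and a
rational `(1,1)`-class `b`.  Proof: by `exists_decomp_codimThree_of_unitaryTwoOne_cmCurve_cube`, `c = c_B + c_W` with `c_B ∈ D³` and
`c_W` rational of type `(3,3)` in the span of the `pr_T^* u ⌣ pr_S^* v` with `(u,v)` of types `((2,1),(1,2))`, `((1,2),(2,1))`; expanding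
`v` in typed words of the letters `q_i^* ω, q_i^* ω̄` (`EllSlots.exists_typed_wordEval_eq`) and splitting `c_W` by the Künneth
projectors onto the blocks of the rational cup-monomial basis of `H³(E³)` indexed by the slot shapes `(1,1,1)` and `(2,1)` at `(a,b′)`
(`powersetCard_three_classify`; each block projection is rational and kills or fixes each typed word monomial,
`blockCount_eq_slotCount_of_repr_cupPowOneAlt_ne_zero`): a `(2,1)`-block is `A ⌣ pr_S^* q_a^*[pt]` with `A` of type `(2,2)` (word
normal form `map_word_of_slotCounts_two_one`, type uniqueness) and RATIONAL (`isRationalClass_of_sum_cup_slot_cup_pointClass`); the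
`(1,1,1)`-block `z` is handled with the shears `x_a ↦ x_a + x_c`, `x_a ↦ x_a + χ(x_c)` of `E³`: `(𝟙 × shear)^* z - z` is a `(2,1)`-block
at `(c, b)` whose rational `(2,2)`-factor is `κ · (P₀ - P₁)`, resp. `κ · (μ P₀ - μ̄ P₁)` (`μ ≠ μ̄` the eigenvalue of `χ^*` on `ω`), for the
two halves `P_r ⌣ pr_S^*(q_a^* ω^{r} ⌣ q_c^* ω^{1-r})` of the `(a,c)`-part of `z`; so `P₀, P₁` are combinations of rational `(2,2)`-classes,
the crosses `q_a^* ω ⌣ q_c^* ω̄` are combinations of rational `(1,1)`-classes (complex multiplication,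
`EllipticCurve.slotLetters_cross_mem_span_rational_oneOne_of_not_hodgeEndTrivial`), and the three `(a,c)`-parts add up to `2z`.
NOT asserted: `D³ ≠ B³`, nor any identification of the factors with Weil classes.
[cite: MoonenZarhin1999LowDim, Thm. 0.2 (1) with cases (a), (e) and §5 (5.3), (5.11)] [cite: MoonenZarhin1999LowDim, (2.8)]
[cite: HatcherAT2002, §3.2 Thm. 3.16] [cite: VoisinHodgeI2002, §11.3.2 Thm. 11.38] [cite: LangeBirkenhake1992, Thm. 4.2.1 and §5] -/
theorem mem_divisorClassesSpan_sup_span_cup_of_unitaryTwoOne_cmCurve_powThree_codimThree (hY3 : Y.dim = 3)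
    (hY2 : Module.finrank ℚ Y.endAlgebra = 2) (φY : Y ⟶ Y) {d : ℕ} (hd : 0 < d) (hφY : φY ≫ φY = -(d • 𝟙 Y))
    (hm1 : eigenMultiplicity Y φY (Complex.I * (Real.sqrt d : ℂ)) = 1 ∨
      eigenMultiplicity Y φY (-(Complex.I * (Real.sqrt d : ℂ))) = 1)
    (hE1 : E.dim = 1) (χ : E ⟶ E) {d' : ℕ} (hd' : 0 < d') (hχ : χ ≫ χ = -(d' • 𝟙 E))
    {c : complexBetti (Y.prod (E.powSucc 2)).X (2 * 3)} (hcQ : IsRationalClass c)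
    (hc : IsOfHodgeType (Y.prod (E.powSucc 2)).dim (Y.prod (E.powSucc 2)).X (2 * 3) 3 3 c) :
    c ∈ divisorClassesSpan (Y.prod (E.powSucc 2)).X (Y.prod (E.powSucc 2)).dim 3 ⊔
      Submodule.span ℂ {w' : complexBetti (Y.prod (E.powSucc 2)).X (2 * 3) |
          ∃ (a : complexBetti (Y.prod (E.powSucc 2)).X (2 * 2)) (b : complexBetti (Y.prod (E.powSucc 2)).X (2 * 1)),
            IsRationalClass a ∧ IsOfHodgeType (Y.prod (E.powSucc 2)).dim (Y.prod (E.powSucc 2)).X (2 * 2) 2 2 a ∧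
            IsRationalClass b ∧ IsOfHodgeType (Y.prod (E.powSucc 2)).dim (Y.prod (E.powSucc 2)).X (2 * 1) 1 1 b ∧
            w' = cupProduct (two_mul_add_two_mul 2 1) a b} := by
  classical
  -- the setting
  have hS3 : (E.powSucc 2).dim = 3 := by
    change ((E.prod E).prod E).dim = 3
    rw [Motives.AbelianVariety.dim_prod, Motives.AbelianVariety.dim_prod, hE1]
  have hXP : IsSmoothProjective (Y.prod (E.powSucc 2)).dim (Y.prod (E.powSucc 2)).X := AbelianVariety.isSmoothProjective_holds
  have hYs : IsSmoothProjective Y.dim Y.X := AbelianVariety.isSmoothProjective_holds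
  have hSs : IsSmoothProjective (E.powSucc 2).dim (E.powSucc 2).X := AbelianVariety.isSmoothProjective_holds
  have hEs : IsSmoothProjective E.dim E.X := AbelianVariety.isSmoothProjective_holds
  obtain ⟨MX⟩ := nonempty_hodgeModel_holds hXP
  have hcup : CupPreservesHodgeType (Y.prod (E.powSucc 2)).dim (Y.prod (E.powSucc 2)).X :=
    cupPreservesHodgeType_of_multiplicative_deRham
      (fun F _ _ _ ↦ Literature.NumberTheory.Transcendental.exists_deRhamIsoFamily_holds F) hXP
  -- the target span `V` and its closure property
  set V := Submodule.span ℂ {w' : complexBetti (Y.prod (E.powSucc 2)).X (2 * 3) |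
      ∃ (a : complexBetti (Y.prod (E.powSucc 2)).X (2 * 2)) (b : complexBetti (Y.prod (E.powSucc 2)).X (2 * 1)),
        IsRationalClass a ∧ IsOfHodgeType (Y.prod (E.powSucc 2)).dim (Y.prod (E.powSucc 2)).X (2 * 2) 2 2 a ∧
        IsRationalClass b ∧ IsOfHodgeType (Y.prod (E.powSucc 2)).dim (Y.prod (E.powSucc 2)).X (2 * 1) 1 1 b ∧
        w' = cupProduct (two_mul_add_two_mul 2 1) a b} with hV
  have hVcl : ∀ A ∈ Submodule.span ℂ {a : complexBetti (Y.prod (E.powSucc 2)).X (2 * 2) |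
        IsRationalClass a ∧ IsOfHodgeType (Y.prod (E.powSucc 2)).dim (Y.prod (E.powSucc 2)).X (2 * 2) 2 2 a},
      ∀ D ∈ Submodule.span ℂ {b : complexBetti (Y.prod (E.powSucc 2)).X 2 |
        IsRationalClass b ∧ IsOfHodgeType (Y.prod (E.powSucc 2)).dim (Y.prod (E.powSucc 2)).X 2 1 1 b},
      cupProduct (show 2 * 2 + 2 * 1 = 2 * 3 by norm_num) A D ∈ V := by
    intro A hA D hD
    induction hD using Submodule.span_induction with
    | mem D hD' =>
      induction hA using Submodule.span_induction with
      | mem A hA' =>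
        exact Submodule.subset_span ⟨A, D, hA'.1, hA'.2, hD'.1, hD'.2, rfl⟩
      | zero => rw [LinearMap.map_zero₂]; exact Submodule.zero_mem _
      | add A A' _ _ h h' => rw [LinearMap.map_add₂]; exact Submodule.add_mem _ h h'
      | smul t A _ h => rw [LinearMap.map_smul₂]; exact Submodule.smul_mem _ _ h
    | zero => rw [map_zero]; exact Submodule.zero_mem _
    | add D D' _ _ h h' => rw [map_add]; exact Submodule.add_mem _ h h'
    | smul t D _ h => rw [map_smul]; exact Submodule.smul_mem _ _ h
  -- the structure theorem
  have hstruct : ∃ cB cW : complexBetti (Y.prod (E.powSucc 2)).X (2 * 3), c = cB + cW ∧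
      cB ∈ divisorClassesSpan (Y.prod (E.powSucc 2)).X (Y.prod (E.powSucc 2)).dim 3 ∧
      IsRationalClass cW ∧ IsOfHodgeType (Y.prod (E.powSucc 2)).dim (Y.prod (E.powSucc 2)).X (2 * 3) 3 3 cW ∧
      cW ∈ Submodule.span ℂ {z : complexBetti (Y.prod (E.powSucc 2)).X (2 * 3) |
        ∃ (u : complexBetti Y.X 3) (v : complexBetti (E.powSucc 2).X 3),
          ((IsOfHodgeType Y.dim Y.X 3 2 1 u ∧ IsOfHodgeType (E.powSucc 2).dim (E.powSucc 2).X 3 1 2 v) ∨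
           (IsOfHodgeType Y.dim Y.X 3 1 2 u ∧ IsOfHodgeType (E.powSucc 2).dim (E.powSucc 2).X 3 2 1 v)) ∧
          z = cupProduct (show 3 + 3 = 2 * 3 by norm_num)
            (complexBetti.map (Motives.AbelianVariety.fst Y (E.powSucc 2)).hom.hom.hom 3 u)
            (complexBetti.map (Motives.AbelianVariety.snd Y (E.powSucc 2)).hom.hom.hom 3 v)} :=
    exists_decomp_codimThree_of_unitaryTwoOne_cmCurve_cube hY3 hY2 φY hd hφY hm1 hE1 χ hd' hχ hcQ hc
  obtain ⟨cB, cW, hc_eq, hcBD, hcWQ, hcW33, hspanW'⟩ := hstruct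
  -- bases of `H¹(E)`; slots; the cup-monomial Künneth basis
  obtain ⟨f, hf0, hgen, hf1⟩ := EllipticCurve.exists_hodge_basis hE1
  have hf1' : IsOfHodgeType E.dim E.X 1 0 1 (f 1) := by rw [hf1]; exact hf0.conjClass hEs
  obtain ⟨e, he⟩ := EllipticCurve.exists_rational_basis hE1
  have hg : EllSlots E (E.powSucc 2) (powSlots E 2) := EllSlots.powSucc hE1 2
  have hT : ¬ EllipticCurve.HodgeEndTrivial E := EllipticCurve.not_hodgeEndTrivial_of_cm hE1 χ hd' hχ
  obtain ⟨κ, hκ0, hκ⟩ := EllipticCurve.exists_cup_basis_eq_smul f e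
  obtain ⟨b, hb⟩ := hg.exists_cupMonomialBasis e
  have hbQ : ∀ k s, IsRationalClass (b k s) := isRationalClass_cupMonomialBasis he b hb
  set θ := LinearEquiv.ofBijective _ (complexBetti_kunneth_bijective hYs hSs (fun j => b j) (2 * 3)) with hθ
  have hθadd : ∀ x x' : complexBetti (Y.prod (E.powSucc 2)).X (2 * 3), θ.symm (x + x') = θ.symm x + θ.symm x' :=
    fun x x' => map_add θ.symm x x'
  have hθsmul : ∀ (t : ℂ) (x : complexBetti (Y.prod (E.powSucc 2)).X (2 * 3)), θ.symm (t • x) = t • θ.symm x :=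
    fun t x => map_smul θ.symm t x
  have hθzero : θ.symm (0 : complexBetti (Y.prod (E.powSucc 2)).X (2 * 3)) = 0 := map_zero θ.symm
  have h3 : 3 < 2 * (E.powSucc 2).dim + 1 := by rw [hS3]; norm_num
  have h36 : ((⟨3, h3⟩ : Fin (2 * (E.powSucc 2).dim + 1)) : ℕ) ≤ 2 * 3 := by change 3 ≤ 2 * 3; norm_num
  let Jof : Set.powersetCard (Fin (3 * 2)) 3 →
      LerayHirsch.Idx (fun J : (Σ j : Fin (2 * (E.powSucc 2).dim + 1), Set.powersetCard (Fin (3 * 2)) j) => (J.1 : ℕ)) (2 * 3) :=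
    fun s => ⟨⟨⟨3, h3⟩, s⟩, h36⟩
  have hJinj : Function.Injective Jof := by
    intro s s' h
    have h' := congrArg (fun I : LerayHirsch.Idx (fun J : (Σ j : Fin (2 * (E.powSucc 2).dim + 1),
      Set.powersetCard (Fin (3 * 2)) j) => (J.1 : ℕ)) (2 * 3) => I.1) h
    simp only [Jof, Sigma.mk.injEq, heq_eq_eq, true_and] at h'
    exact h'
  -- letters and word monomials
  set FS := cupPowOneAlt ℂ (Motives.ComplexPoints (E.powSucc 2).X) 3 with hFS
  set Lf := slotLetters (powSlots E 2) f with hLf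
  set Le := slotLetters (powSlots E 2) e with hLe
  have hLf0 : ∀ il : Fin 3 × Fin 2, il.2 = 0 → IsOfHodgeType (E.powSucc 2).dim (E.powSucc 2).X 1 1 0 (Lf il) := by
    rintro ⟨i, l⟩ hl; change l = 0 at hl; subst hl
    exact hf0.map_of_isSmoothProjective hSs hEs _
  have hLf1 : ∀ il : Fin 3 × Fin 2, il.2 = 1 → IsOfHodgeType (E.powSucc 2).dim (E.powSucc 2).X 1 0 1 (Lf il) := by
    rintro ⟨i, l⟩ hl; change l = 1 at hl; subst hl
    exact hf1'.map_of_isSmoothProjective hSs hEs _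
  have hLeQ : ∀ il, IsRationalClass (Le il) := fun il => isRationalClass_slotLetters _ he il
  -- (1) the typed generators
  have hG : cW ∈ Submodule.span ℂ {x : complexBetti (Y.prod (E.powSucc 2)).X (2 * 3) |
      ∃ (u : complexBetti Y.X 3) (w : Fin 3 → Fin 3 × Fin 2) (p₁ q₁ : ℕ), IsOfHodgeType Y.dim Y.X 3 p₁ q₁ u ∧
        ((p₁ = 2 ∧ q₁ = 1 ∧ wordContent (colourWord w) 0 = 1 ∧ wordContent (colourWord w) 1 = 2) ∨
         (p₁ = 1 ∧ q₁ = 2 ∧ wordContent (colourWord w) 0 = 2 ∧ wordContent (colourWord w) 1 = 1)) ∧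
        x = cupProduct (show 3 + 3 = 2 * 3 by norm_num)
          (complexBetti.map (Motives.AbelianVariety.fst Y (E.powSucc 2)).hom.hom.hom 3 u)
          (complexBetti.map (Motives.AbelianVariety.snd Y (E.powSucc 2)).hom.hom.hom 3 (FS (Lf ∘ w)))} := by
    refine (Submodule.span_le.2 ?_) hspanW'
    rintro _ ⟨u, v, huv, rfl⟩
    -- expand `v` in typed words
    have hv : ∃ p₀ q₀ p₁ q₁ : ℕ, IsOfHodgeType Y.dim Y.X 3 p₁ q₁ u ∧
        IsOfHodgeType (E.powSucc 2).dim (E.powSucc 2).X 3 p₀ q₀ v ∧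
        ((p₁ = 2 ∧ q₁ = 1 ∧ p₀ = 1 ∧ q₀ = 2) ∨ (p₁ = 1 ∧ q₁ = 2 ∧ p₀ = 2 ∧ q₀ = 1)) := by
      rcases huv with ⟨hu, hv⟩ | ⟨hu, hv⟩
      · exact ⟨1, 2, 2, 1, hu, hv, Or.inl ⟨rfl, rfl, rfl, rfl⟩⟩
      · exact ⟨2, 1, 1, 2, hu, hv, Or.inr ⟨rfl, rfl, rfl, rfl⟩⟩
    obtain ⟨p₀, q₀, p₁, q₁, hu, hv, hpq⟩ := hv
    have hpq₀ : p₀ + q₀ = 3 := by rcases hpq with ⟨-, -, h, h'⟩ | ⟨-, -, h, h'⟩ <;> omega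
    obtain ⟨aw, haw, hawv⟩ := hg.exists_typed_wordEval_eq f hf0 hf1' (by norm_num : 0 < 3) hpq₀ hv
    change cupProduct (show 3 + 3 = 2 * 3 by norm_num)
      (complexBetti.map (Motives.AbelianVariety.fst Y (E.powSucc 2)).hom.hom.hom 3 u)
      (complexBetti.map (Motives.AbelianVariety.snd Y (E.powSucc 2)).hom.hom.hom 3 v) ∈ _
    rw [← hawv, wordEval_apply, map_sum, map_sum]
    refine Submodule.sum_mem _ fun w _ => ?_
    rw [map_smul, map_smul]
    by_cases hw0 : aw w = 0
    · rw [hw0, zero_smul]; exact Submodule.zero_mem _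
    refine Submodule.smul_mem _ _ (Submodule.subset_span ⟨u, w, p₁, q₁, hu, ?_, rfl⟩)
    obtain ⟨hc0, hc1⟩ := haw w hw0
    rcases hpq with ⟨h1, h2, h3', h4⟩ | ⟨h1, h2, h3', h4⟩
    · exact Or.inl ⟨h1, h2, h3' ▸ hc0, h4 ▸ hc1⟩
    · exact Or.inr ⟨h1, h2, h3' ▸ hc0, h4 ▸ hc1⟩
  -- (2) Künneth coefficients of a generator
  have hθgen : ∀ (u : complexBetti Y.X 3) (v : complexBetti (E.powSucc 2).X 3),
      θ.symm (cupProduct (show 3 + 3 = 2 * 3 by norm_num)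
        (complexBetti.map (Motives.AbelianVariety.fst Y (E.powSucc 2)).hom.hom.hom 3 u)
        (complexBetti.map (Motives.AbelianVariety.snd Y (E.powSucc 2)).hom.hom.hom 3 v)) =
        ∑ i, (b 3).repr v i • (Pi.single (Jof i) (show complexBetti Y.X (2 * 3 - 3) from u) :
          LerayHirsch.Src ℂ (fun J : (Σ j : Fin (2 * (E.powSucc 2).dim + 1), Set.powersetCard (Fin (3 * 2)) j) => (J.1 : ℕ))
            (Motives.ComplexPoints Y.X) (2 * 3)) := by
    intro u v
    exact kunneth_symm_cupProduct_eq_sum hYs hSs (fun j => b j) (2 * 3) (j := ⟨3, h3⟩) h36 u v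
  have hθgen_at : ∀ (u : complexBetti Y.X 3) (v : complexBetti (E.powSucc 2).X 3) (s : Set.powersetCard (Fin (3 * 2)) 3),
      θ.symm (cupProduct (show 3 + 3 = 2 * 3 by norm_num)
        (complexBetti.map (Motives.AbelianVariety.fst Y (E.powSucc 2)).hom.hom.hom 3 u)
        (complexBetti.map (Motives.AbelianVariety.snd Y (E.powSucc 2)).hom.hom.hom 3 v)) (Jof s) =
        (b 3).repr v s • (show complexBetti Y.X (2 * 3 - 3) from u) := by
    intro u v s
    rw [hθgen, Finset.sum_apply, Finset.sum_eq_single s]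
    · rw [Pi.smul_apply, Pi.single_eq_same]
    · intro i _ hi
      rw [Pi.smul_apply, Pi.single_eq_of_ne (fun h => hi (hJinj h).symm), smul_zero]
    · exact fun h => absurd (Finset.mem_univ _) h
  have hθgen_off : ∀ (u : complexBetti Y.X 3) (v : complexBetti (E.powSucc 2).X 3)
      (J : LerayHirsch.Idx (fun J : (Σ j : Fin (2 * (E.powSucc 2).dim + 1), Set.powersetCard (Fin (3 * 2)) j) => (J.1 : ℕ)) (2 * 3)),
      (∀ s, J ≠ Jof s) →
      θ.symm (cupProduct (show 3 + 3 = 2 * 3 by norm_num)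
        (complexBetti.map (Motives.AbelianVariety.fst Y (E.powSucc 2)).hom.hom.hom 3 u)
        (complexBetti.map (Motives.AbelianVariety.snd Y (E.powSucc 2)).hom.hom.hom 3 v)) J = 0 := by
    intro u v J hJ
    rw [hθgen, Finset.sum_apply]
    refine Finset.sum_eq_zero fun i _ => ?_
    rw [Pi.smul_apply, Pi.single_eq_of_ne (hJ i), smul_zero]
  -- (3) the block projectors
  let proj : (Set.powersetCard (Fin (3 * 2)) 3 → Prop) → complexBetti (Y.prod (E.powSucc 2)).X (2 * 3) →
      complexBetti (Y.prod (E.powSucc 2)).X (2 * 3) :=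
    fun P x => θ (fun J => if ∃ s, P s ∧ J = Jof s then θ.symm x J else 0)
  have hproj_add : ∀ P x x', proj P (x + x') = proj P x + proj P x' := by
    intro P x x'
    change θ _ = θ _ + θ _
    rw [← map_add]; congr 1; funext J
    simp only [Pi.add_apply, hθadd]
    split_ifs <;> simp
  have hproj_smul : ∀ P (t : ℂ) x, proj P (t • x) = t • proj P x := by
    intro P t x
    change θ _ = t • θ _
    rw [← map_smul]; congr 1; funext J
    simp only [Pi.smul_apply, hθsmul]
    split_ifs <;> simp
  have hprojQ : ∀ P x, IsRationalClass x → IsRationalClass (proj P x) := by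
    intro P x hx
    change IsRationalClass (θ _)
    rw [hθ, LinearEquiv.ofBijective_apply, LerayHirsch.lhMap_eq_sum_idx]
    refine isRationalClass_sum _ _ fun J _ => ?_
    refine (IsRationalClass.map _ ?_).cup _ ((hbQ J.1.1 J.1.2).map _)
    dsimp only
    split_ifs with hJ
    · exact isRationalClass_kunneth_symm_apply hYs hSs (fun j => b j) (fun j i => hbQ j i) (2 * 3) hx J
    · exact IsRationalClass.zero
  -- a projector fixes or kills each word generator, according to the slot counts of the word
  have hproj_fix : ∀ (P : Set.powersetCard (Fin (3 * 2)) 3 → Prop) (u : complexBetti Y.X 3) (w : Fin 3 → Fin 3 × Fin 2),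
      (∀ s : Set.powersetCard (Fin (3 * 2)) 3,
        (∀ a, (s.val.filter fun j => (finProdFinEquiv.symm j).1 = a).card = (Finset.univ.filter fun t => (w t).1 = a).card) → P s) →
      proj P (cupProduct (show 3 + 3 = 2 * 3 by norm_num)
        (complexBetti.map (Motives.AbelianVariety.fst Y (E.powSucc 2)).hom.hom.hom 3 u)
        (complexBetti.map (Motives.AbelianVariety.snd Y (E.powSucc 2)).hom.hom.hom 3 (FS (Lf ∘ w)))) =
      cupProduct (show 3 + 3 = 2 * 3 by norm_num)
        (complexBetti.map (Motives.AbelianVariety.fst Y (E.powSucc 2)).hom.hom.hom 3 u)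
        (complexBetti.map (Motives.AbelianVariety.snd Y (E.powSucc 2)).hom.hom.hom 3 (FS (Lf ∘ w))) := by
    intro P u w hP
    change θ _ = _
    conv_rhs => rw [← θ.apply_symm_apply (cupProduct (show 3 + 3 = 2 * 3 by norm_num)
      (complexBetti.map (Motives.AbelianVariety.fst Y (E.powSucc 2)).hom.hom.hom 3 u)
      (complexBetti.map (Motives.AbelianVariety.snd Y (E.powSucc 2)).hom.hom.hom 3 (FS (Lf ∘ w))))]
    congr 1
    funext J
    split_ifs with hJ
    · rfl
    · symm
      by_cases hJ' : ∃ s, J = Jof s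
      · obtain ⟨s, rfl⟩ := hJ'
        rw [hθgen_at]
        have hrepr : (b 3).repr (FS (Lf ∘ w)) s = 0 := by
          by_contra hne
          exact hJ ⟨s, hP s (blockCount_eq_slotCount_of_repr_cupPowOneAlt_ne_zero e b hb f w s hne), rfl⟩
        rw [hrepr, zero_smul]
      · push Not at hJ'
        exact hθgen_off u _ J hJ'
  have hproj_kill : ∀ (P : Set.powersetCard (Fin (3 * 2)) 3 → Prop) (u : complexBetti Y.X 3) (w : Fin 3 → Fin 3 × Fin 2),
      (∀ s : Set.powersetCard (Fin (3 * 2)) 3,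
        (∀ a, (s.val.filter fun j => (finProdFinEquiv.symm j).1 = a).card = (Finset.univ.filter fun t => (w t).1 = a).card) → ¬ P s) →
      proj P (cupProduct (show 3 + 3 = 2 * 3 by norm_num)
        (complexBetti.map (Motives.AbelianVariety.fst Y (E.powSucc 2)).hom.hom.hom 3 u)
        (complexBetti.map (Motives.AbelianVariety.snd Y (E.powSucc 2)).hom.hom.hom 3 (FS (Lf ∘ w)))) = 0 := by
    intro P u w hP
    change θ _ = 0
    rw [← map_zero θ]
    congr 1
    funext J
    split_ifs with hJ
    · obtain ⟨s, hs, rfl⟩ := hJ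
      rw [hθgen_at]
      have hrepr : (b 3).repr (FS (Lf ∘ w)) s = 0 := by
        by_contra hne
        exact hP s (blockCount_eq_slotCount_of_repr_cupPowOneAlt_ne_zero e b hb f w s hne) hs
      rw [hrepr, zero_smul]; rfl
    · rfl
  -- (4) the decomposition of `c_W` into its blocks
  have hsuppW : ∀ J, (∀ s, J ≠ Jof s) → θ.symm cW J = 0 := by
    intro J hJ
    refine Submodule.span_induction (p := fun x _ => θ.symm x J = 0) ?_ ?_ ?_ ?_ hG
    · rintro x ⟨u, w, p₁, q₁, -, -, rfl⟩; exact hθgen_off u _ J hJ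
    · show θ.symm (0 : complexBetti (Y.prod (E.powSucc 2)).X (2 * 3)) J = 0
      rw [hθzero]; rfl
    · intro x x' _ _ h h'
      have e := congrArg (fun F => F J) (map_add θ.symm x x')
      simp only [Pi.add_apply, h, h', add_zero] at e
      exact e
    · intro t x _ h
      have e := congrArg (fun F => F J) (map_smul θ.symm t x)
      simp only [Pi.smul_apply, h, smul_zero] at e
      exact e
  let K : Set.powersetCard (Fin (3 * 2)) 3 → Prop := fun s =>
    ∀ a : Fin 3, (s.val.filter fun j => (finProdFinEquiv.symm j).1 = a).card = 1
  let N : Fin 3 → Fin 3 → Set.powersetCard (Fin (3 * 2)) 3 → Prop := fun a b' s =>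
    ∃ (hab : a ≠ b') (r : Fin 2), s = Set.powersetCard.ofCard (card_image_stdWord_two_one hab r)
  set Fp := (Finset.univ : Finset (Fin 3 × Fin 3)).filter (fun p => p.1 ≠ p.2) with hFp
  have hθproj : ∀ P x, θ.symm (proj P x) = fun J => if ∃ s, P s ∧ J = Jof s then θ.symm x J else 0 :=
    fun P x => θ.symm_apply_apply _
  have hdecomp : cW = proj K cW + ∑ p ∈ Fp, proj (N p.1 p.2) cW := by
    apply θ.symm.injective
    have hsum : θ.symm ((∑ p ∈ Fp, proj (N p.1 p.2) cW : complexBetti (Y.prod (E.powSucc 2)).X (2 * 3))) =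
        ∑ p ∈ Fp, θ.symm (proj (N p.1 p.2) cW) := map_sum θ.symm _ _
    rw [hθadd, hsum]
    funext J
    rw [Pi.add_apply, Finset.sum_apply]
    simp only [hθproj]
    by_cases hJ : ∃ s, J = Jof s
    · obtain ⟨s, rfl⟩ := hJ
      rcases powersetCard_three_classify s with hKs | ⟨a, b', hab, r, rfl⟩
      · rw [if_pos ⟨s, hKs, rfl⟩]
        symm
        rw [add_eq_left]
        refine Finset.sum_eq_zero fun p _ => ?_
        rw [if_neg]
        rintro ⟨s', ⟨hab', r', hs'⟩, hJs'⟩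
        have hss' := hJinj hJs'
        rw [hss', hs'] at hKs
        exact (stdSubset_shape hab' r').1 hKs
      · have hnotK : ¬ ∃ s', K s' ∧ Jof (Set.powersetCard.ofCard (card_image_stdWord_two_one hab r)) = Jof s' := by
          rintro ⟨s', hKs', hJs'⟩
          have hss' := hJinj hJs'
          rw [← hss'] at hKs'
          exact (stdSubset_shape hab r).1 hKs'
        rw [if_neg hnotK, zero_add, Finset.sum_eq_single (a, b')]
        · rw [if_pos ⟨_, ⟨hab, r, rfl⟩, rfl⟩]
        · intro p _ hpne
          rw [if_neg]
          rintro ⟨s', ⟨hab', r', hs'⟩, hJs'⟩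
          have hss' := hJinj hJs'
          obtain ⟨h1, h2⟩ := (stdSubset_shape hab r).2 p.1 p.2 hab' r' (hss'.trans hs')
          exact hpne (Prod.ext h1 h2)
        · intro h
          exact absurd (Finset.mem_filter.2 ⟨Finset.mem_univ (a, b'), hab⟩ : (a, b') ∈ Fp) h
    · push Not at hJ
      rw [hsuppW J hJ, if_neg, zero_add]
      · symm
        refine Finset.sum_eq_zero fun p _ => ?_
        rw [if_neg]
        rintro ⟨s', -, hJs'⟩
        exact hJ s' hJs'
      · rintro ⟨s', -, hJs'⟩
        exact hJ s' hJs'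
  -- (5) Hodge types of the generators
  have hScontent : ∀ w : Fin 3 → Fin 3 × Fin 2, IsOfHodgeType (E.powSucc 2).dim (E.powSucc 2).X 3
      (wordContent (colourWord w) 0) (wordContent (colourWord w) 1) (FS (Lf ∘ w)) := by
    intro w
    have h := isOfHodgeType_cupPowOne_of_kinds Lf hLf0 hLf1 w
    have e0 : (∑ t, if (w t).2 = 0 then 1 else 0 : ℕ) = wordContent (colourWord w) 0 := by
      rw [← Finset.card_filter]; rfl
    have e1 : (∑ t, if (w t).2 = 0 then 0 else 1 : ℕ) = wordContent (colourWord w) 1 := by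
      have h' : ∀ t, (if (w t).2 = 0 then 0 else 1 : ℕ) = if (w t).2 = 1 then 1 else 0 := fun t => by
        rcases fin2_eq_zero_or_one_cc (w t).2 with h0 | h0 <;> simp [h0]
      simp only [h']
      rw [← Finset.card_filter]; rfl
    rw [e0, e1] at h
    rw [hFS, cupPowOneAlt_apply]
    exact h
  have hgtype : ∀ (u : complexBetti Y.X 3) (w : Fin 3 → Fin 3 × Fin 2) (p₁ q₁ : ℕ), IsOfHodgeType Y.dim Y.X 3 p₁ q₁ u →
      p₁ + wordContent (colourWord w) 0 = 3 → q₁ + wordContent (colourWord w) 1 = 3 →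
      IsOfHodgeType (Y.prod (E.powSucc 2)).dim (Y.prod (E.powSucc 2)).X (2 * 3) 3 3
        (cupProduct (show 3 + 3 = 2 * 3 by norm_num)
          (complexBetti.map (Motives.AbelianVariety.fst Y (E.powSucc 2)).hom.hom.hom 3 u)
          (complexBetti.map (Motives.AbelianVariety.snd Y (E.powSucc 2)).hom.hom.hom 3 (FS (Lf ∘ w)))) := by
    intro u w p₁ q₁ hu hp hq
    have h := hcup (show 3 + 3 = 2 * 3 by norm_num)
      (hu.map_of_isSmoothProjective hXP hYs (Motives.AbelianVariety.fst Y (E.powSucc 2)).hom.hom.hom)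
      ((hScontent w).map_of_isSmoothProjective hXP hSs (Motives.AbelianVariety.snd Y (E.powSucc 2)).hom.hom.hom)
    rw [hp, hq] at h
    exact h
  -- (6) the `(2,1)`-blocks are products `A ⌣ pr_S^* q_a^*[pt]`
  have hcupS : CupPreservesHodgeType (E.powSucc 2).dim (E.powSucc 2).X :=
    cupPreservesHodgeType_of_multiplicative_deRham
      (fun F _ _ _ ↦ Literature.NumberTheory.Transcendental.exists_deRhamIsoFamily_holds F) hSs
  have hNblock : ∀ a b' : Fin 3, a ≠ b' → proj (N a b') cW ∈ V := by
    intro a b' hab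
    -- the point-class factor
    set DS := cupProduct (rfl : 1 + 1 = 2) (Le (a, 0)) (Le (a, 1)) with hDS
    have hDSf : cupProduct (rfl : 1 + 1 = 2) (Lf (a, 0)) (Lf (a, 1)) = κ • DS := by
      rw [hDS, hLf, hLe, slotLetters_apply, slotLetters_apply, slotLetters_apply, slotLetters_apply,
        ← complexBetti.map_cupProduct, ← complexBetti.map_cupProduct, hκ, map_smul]
    have hDS11 : IsOfHodgeType (E.powSucc 2).dim (E.powSucc 2).X 2 1 1 DS := by
      have h := hcupS (rfl : 1 + 1 = 2) (hLf0 (a, 0) rfl) (hLf1 (a, 1) rfl)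
      rw [hDSf] at h
      have h' := h.smul κ⁻¹
      rwa [smul_smul, inv_mul_cancel₀ hκ0, one_smul] at h'
    set DX := complexBetti.map (Motives.AbelianVariety.snd Y (E.powSucc 2)).hom.hom.hom 2 DS with hDX
    have hDX11 : IsOfHodgeType (Y.prod (E.powSucc 2)).dim (Y.prod (E.powSucc 2)).X 2 1 1 DX :=
      hDS11.map_of_isSmoothProjective hXP hSs _
    have hDXmem : DX ∈ Submodule.span ℂ {b : complexBetti (Y.prod (E.powSucc 2)).X 2 |
        IsRationalClass b ∧ IsOfHodgeType (Y.prod (E.powSucc 2)).dim (Y.prod (E.powSucc 2)).X 2 1 1 b} := by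
      refine map_mem_span_rational_oneOne hXP hSs _ ?_
      rw [hDS, hLe, slotLetters_apply, slotLetters_apply, ← complexBetti.map_cupProduct]
      exact EllipticCurve.map_slot_two_mem_span_rational_oneOne hE1 _ _
    -- the map `Φ`
    let Φ : (Fin 2 → complexBetti Y.X 3) → complexBetti (Y.prod (E.powSucc 2)).X (2 * 2) := fun γ =>
      ∑ j, cupProduct (show 3 + 1 = 2 * 2 by norm_num)
        (complexBetti.map (Motives.AbelianVariety.fst Y (E.powSucc 2)).hom.hom.hom 3 (γ j))
        (complexBetti.map (Motives.AbelianVariety.snd Y (E.powSucc 2)).hom.hom.hom 1 (Le (b', j)))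
    have hΦadd : ∀ γ γ', Φ (γ + γ') = Φ γ + Φ γ' := by
      intro γ γ'
      simp only [Φ, Pi.add_apply, map_add, LinearMap.add_apply, Finset.sum_add_distrib]
    have hΦsmul : ∀ (t : ℂ) γ, Φ (t • γ) = t • Φ γ := by
      intro t γ
      simp only [Φ, Pi.smul_apply, map_smul, LinearMap.smul_apply, Finset.smul_sum]
    have hΦzero : Φ 0 = 0 := by
      have h := hΦsmul 0 0
      rwa [zero_smul, zero_smul] at h
    -- the letter `f_r` of slot `b'` in the basis `e`
    have hLfe : ∀ r : Fin 2, Lf (b', r) = ∑ j, e.repr (f r) j • Le (b', j) := fun r => by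
      rw [hLf, hLe]
      exact slotLetters_baseChange (powSlots E 2) (fun j l => e.repr (f l) j) (fun l => by
        conv_lhs => rw [← e.sum_repr (f l)]) b' r
    have hGΦ : ∀ (u : complexBetti Y.X 3) (r : Fin 2),
        cupProduct (show 3 + 1 = 2 * 2 by norm_num)
          (complexBetti.map (Motives.AbelianVariety.fst Y (E.powSucc 2)).hom.hom.hom 3 u)
          (complexBetti.map (Motives.AbelianVariety.snd Y (E.powSucc 2)).hom.hom.hom 1 (Lf (b', r))) =
        Φ (fun j => e.repr (f r) j • u) := by
      intro u r
      simp only [Φ]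
      rw [hLfe r, map_sum, map_sum]
      refine Finset.sum_congr rfl fun j _ => ?_
      rw [map_smul, map_smul, LinearMap.map_smul, LinearMap.map_smul₂]
    -- typed form of the block
    have htyped : ∃ γ, proj (N a b') cW = cupProduct (show 2 * 2 + 2 * 1 = 2 * 3 by norm_num) (Φ γ) DX ∧
        IsOfHodgeType (Y.prod (E.powSucc 2)).dim (Y.prod (E.powSucc 2)).X (2 * 2) 2 2 (Φ γ) := by
      refine Submodule.span_induction
        (p := fun x _ => ∃ γ, proj (N a b') x = cupProduct (show 2 * 2 + 2 * 1 = 2 * 3 by norm_num) (Φ γ) DX ∧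
          IsOfHodgeType (Y.prod (E.powSucc 2)).dim (Y.prod (E.powSucc 2)).X (2 * 2) 2 2 (Φ γ)) ?_ ?_ ?_ ?_ hG
      · rintro x ⟨u, w, p₁, q₁, hu, hpq, rfl⟩
        by_cases hSC : (Finset.univ.filter fun t => (w t).1 = a).card = 2 ∧ (Finset.univ.filter fun t => (w t).1 = b').card = 1
        · -- the projector fixes this generator
          have hfixhyp : ∀ s : Set.powersetCard (Fin (3 * 2)) 3,
              (∀ c', (s.val.filter fun j => (finProdFinEquiv.symm j).1 = c').card =
                (Finset.univ.filter fun t => (w t).1 = c').card) → N a b' s := by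
            intro s hs
            rcases powersetCard_three_classify s with hKs | ⟨a'', b'', hab'', r'', rfl⟩
            · exact absurd ((hKs a).symm.trans ((hs a).trans hSC.1)) (by decide)
            · have hc := blockCount_std_two_one hab'' r''
              have ha : a'' = a := by
                have h := (hc a).symm.trans ((hs a).trans hSC.1)
                by_cases h1 : a = a''
                · exact h1.symm
                · rw [if_neg h1] at h
                  by_cases h2 : a = b''
                  · rw [if_pos h2] at h; exact absurd h (by decide)
                  · rw [if_neg h2] at h; exact absurd h (by decide)
              have hb : b'' = b' := by
                have h := (hc b').symm.trans ((hs b').trans hSC.2)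
                by_cases h1 : b' = a''
                · exact absurd (h1.trans ha).symm hab
                · rw [if_neg h1] at h
                  by_cases h2 : b' = b''
                  · exact h2.symm
                  · rw [if_neg h2] at h; exact absurd h (by decide)
              subst ha hb
              exact ⟨hab'', r'', rfl⟩
          rw [hproj_fix (N a b') u w hfixhyp]
          -- word normal form
          obtain ⟨t, ε, htb, hε, hnf⟩ := map_word_of_slotCounts_two_one FS Lf w hab hSC.1 hSC.2
          set r := (w t).2 with hr
          set G := cupProduct (show 3 + 1 = 2 * 2 by norm_num)
            (complexBetti.map (Motives.AbelianVariety.fst Y (E.powSucc 2)).hom.hom.hom 3 u)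
            (complexBetti.map (Motives.AbelianVariety.snd Y (E.powSucc 2)).hom.hom.hom 1 (Lf (b', r))) with hGdef
          have hv : FS (Lf ∘ w) = ((ε : ℂ) * κ) • cupProduct (show 2 + 1 = 3 by norm_num) DS (Lf (b', r)) := by
            rw [hnf, cupPowOneAlt_three', hDSf, LinearMap.map_smul₂, smul_smul]
          have hg : cupProduct (show 3 + 3 = 2 * 3 by norm_num)
              (complexBetti.map (Motives.AbelianVariety.fst Y (E.powSucc 2)).hom.hom.hom 3 u)
              (complexBetti.map (Motives.AbelianVariety.snd Y (E.powSucc 2)).hom.hom.hom 3 (FS (Lf ∘ w))) =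
              ((ε : ℂ) * κ) • cupProduct (show 2 * 2 + 2 * 1 = 2 * 3 by norm_num) G DX := by
            rw [hv, map_smul, LinearMap.map_smul, cup_fst_three_snd_two_cup_one]
          -- Hodge types: `G` is of type `(2,2)` unless `G ⌣ DX = 0`
          by_cases hz : ((ε : ℂ) * κ) • cupProduct (show 2 * 2 + 2 * 1 = 2 * 3 by norm_num) G DX = 0
          · refine ⟨0, ?_, ?_⟩
            · rw [hg, hz, hΦzero, LinearMap.map_zero₂]
            · rw [hΦzero]; exact IsOfHodgeType.zero MX _ _ _
          have hεκ : ((ε : ℂ) * κ) ≠ 0 := fun h => hz (by rw [h, zero_smul])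
          have hGD33 : IsOfHodgeType (Y.prod (E.powSucc 2)).dim (Y.prod (E.powSucc 2)).X (2 * 3) 3 3
              (cupProduct (show 2 * 2 + 2 * 1 = 2 * 3 by norm_num) G DX) := by
            have h := hgtype u w p₁ q₁ hu (by rcases hpq with ⟨h1, -, h3, -⟩ | ⟨h1, -, h3, -⟩ <;> omega)
              (by rcases hpq with ⟨-, h2, -, h4⟩ | ⟨-, h2, -, h4⟩ <;> omega)
            rw [hg] at h
            have h' := h.smul ((ε : ℂ) * κ)⁻¹
            rwa [smul_smul, inv_mul_cancel₀ hεκ, one_smul] at h'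
          have hG22 : IsOfHodgeType (Y.prod (E.powSucc 2)).dim (Y.prod (E.powSucc 2)).X (2 * 2) 2 2 G := by
            have hGD0 : cupProduct (show 2 * 2 + 2 * 1 = 2 * 3 by norm_num) G DX ≠ 0 := fun h => hz (by rw [h, smul_zero])
            rcases fin2_eq_zero_or_one_cc r with hr0 | hr0
            · have hL : IsOfHodgeType (Y.prod (E.powSucc 2)).dim (Y.prod (E.powSucc 2)).X 1 1 0
                  (complexBetti.map (Motives.AbelianVariety.snd Y (E.powSucc 2)).hom.hom.hom 1 (Lf (b', r))) :=
                (hLf0 (b', r) hr0).map_of_isSmoothProjective hXP hSs _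
              have hGt := hcup (show 3 + 1 = 2 * 2 by norm_num)
                (hu.map_of_isSmoothProjective hXP hYs (Motives.AbelianVariety.fst Y (E.powSucc 2)).hom.hom.hom) hL
              rcases hpq with ⟨h1, h2, -, -⟩ | ⟨h1, h2, -, -⟩ <;> subst h1 h2
              · exfalso
                exact hGD0 ((hcup (show 2 * 2 + 2 * 1 = 2 * 3 by norm_num) hGt hDX11).eq_zero_of_ne hXP hGD33 (by decide))
              · exact hGt
            · have hL : IsOfHodgeType (Y.prod (E.powSucc 2)).dim (Y.prod (E.powSucc 2)).X 1 0 1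
                  (complexBetti.map (Motives.AbelianVariety.snd Y (E.powSucc 2)).hom.hom.hom 1 (Lf (b', r))) :=
                (hLf1 (b', r) hr0).map_of_isSmoothProjective hXP hSs _
              have hGt := hcup (show 3 + 1 = 2 * 2 by norm_num)
                (hu.map_of_isSmoothProjective hXP hYs (Motives.AbelianVariety.fst Y (E.powSucc 2)).hom.hom.hom) hL
              rcases hpq with ⟨h1, h2, -, -⟩ | ⟨h1, h2, -, -⟩ <;> subst h1 h2
              · exact hGt
              · exfalso
                exact hGD0 ((hcup (show 2 * 2 + 2 * 1 = 2 * 3 by norm_num) hGt hDX11).eq_zero_of_ne hXP hGD33 (by decide))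
          refine ⟨((ε : ℂ) * κ) • fun j => e.repr (f r) j • u, ?_, ?_⟩
          · rw [hg, hΦsmul, ← hGΦ, LinearMap.map_smul₂]
          · rw [hΦsmul, ← hGΦ]; exact hG22.smul _
        · -- the projector kills this generator
          have hkillhyp : ∀ s : Set.powersetCard (Fin (3 * 2)) 3,
              (∀ c', (s.val.filter fun j => (finProdFinEquiv.symm j).1 = c').card =
                (Finset.univ.filter fun t => (w t).1 = c').card) → ¬ N a b' s := by
            rintro s hs ⟨hab'', r'', rfl⟩
            have hc := blockCount_std_two_one hab'' r''
            apply hSC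
            refine ⟨?_, ?_⟩
            · exact (hs a).symm.trans (by have h := hc a; rwa [if_pos rfl] at h)
            · exact (hs b').symm.trans (by have h := hc b'; rwa [if_neg (Ne.symm hab''), if_pos rfl] at h)
          refine ⟨0, ?_, ?_⟩
          · rw [hproj_kill (N a b') u w hkillhyp, hΦzero, LinearMap.map_zero₂]
          · rw [hΦzero]; exact IsOfHodgeType.zero MX _ _ _
      · refine ⟨0, ?_, ?_⟩
        · have h0 : proj (N a b') 0 = 0 := by
            have h := hproj_smul (N a b') 0 0
            rwa [zero_smul, zero_smul] at h
          rw [h0, hΦzero, LinearMap.map_zero₂]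
        · rw [hΦzero]; exact IsOfHodgeType.zero MX _ _ _
      · rintro x x' - - ⟨γ, hx, hγ⟩ ⟨γ', hx', hγ'⟩
        refine ⟨γ + γ', ?_, ?_⟩
        · rw [hproj_add, hx, hx', hΦadd, LinearMap.map_add₂]
        · rw [hΦadd]; exact hγ.add hXP hγ'
      · rintro t x - ⟨γ, hx, hγ⟩
        refine ⟨t • γ, ?_, ?_⟩
        · rw [hproj_smul, hx, hΦsmul, LinearMap.map_smul₂]
        · rw [hΦsmul]; exact hγ.smul _
    obtain ⟨γ, hproj_eq, hΦtype⟩ := htyped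
    -- rationality by descent along the point class
    have hγQ : ∀ j, IsRationalClass (γ j) := by
      refine isRationalClass_of_sum_cup_slot_cup_pointClass hE1 he hab γ ?_
      have h := hprojQ (N a b') cW hcWQ
      rw [hproj_eq] at h
      exact h
    have hΦQ : IsRationalClass (Φ γ) :=
      isRationalClass_sum _ _ fun j _ => ((hγQ j).map _).cup _ ((hLeQ (b', j)).map _)
    rw [hproj_eq]
    exact hVcl _ (Submodule.subset_span ⟨hΦQ, hΦtype⟩) _ hDXmem
  -- (7) the `(1,1,1)`-block
  have hKblock : proj K cW ∈ V := by
    -- (i) the block and its typed generators: colour patterns `ε` in slot order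
    set z := proj K cW with hz
    have hzQ : IsRationalClass z := hprojQ K cW hcWQ
    have hzspan : z ∈ Submodule.span ℂ {x : complexBetti (Y.prod (E.powSucc 2)).X (2 * 3) |
        ∃ (u : complexBetti Y.X 3) (ε : Fin 3 → Fin 2) (p₁ q₁ : ℕ), IsOfHodgeType Y.dim Y.X 3 p₁ q₁ u ∧
          ((p₁ = 2 ∧ q₁ = 1 ∧ (Finset.univ.filter fun c => ε c = 0).card = 1) ∨
           (p₁ = 1 ∧ q₁ = 2 ∧ (Finset.univ.filter fun c => ε c = 0).card = 2)) ∧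
          x = cupProduct (show 3 + 3 = 2 * 3 by norm_num)
            (complexBetti.map (Motives.AbelianVariety.fst Y (E.powSucc 2)).hom.hom.hom 3 u)
            (complexBetti.map (Motives.AbelianVariety.snd Y (E.powSucc 2)).hom.hom.hom 3 (FS (fun c => Lf (c, ε c))))} := by
      rw [hz]
      refine Submodule.span_induction (p := fun x _ => proj K x ∈ _) ?_ ?_ ?_ ?_ hG
      · rintro x ⟨u, w, p₁, q₁, hu, hpq, rfl⟩
        by_cases hSK : ∀ c, (Finset.univ.filter fun t => (w t).1 = c).card = 1
        · rw [hproj_fix K u w (fun s hs c => (hs c).trans (hSK c))]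
          -- the slot map of `w` is a bijection
          have hinj : Function.Injective fun t => (w t).1 := by
            intro t t' htt'
            obtain ⟨t₀, ht₀⟩ := Finset.card_eq_one.1 (hSK (w t).1)
            have ht : t ∈ Finset.univ.filter fun t'' => (w t'').1 = (w t).1 := Finset.mem_filter.2 ⟨Finset.mem_univ _, rfl⟩
            have ht' : t' ∈ Finset.univ.filter fun t'' => (w t'').1 = (w t).1 :=
              Finset.mem_filter.2 ⟨Finset.mem_univ _, htt'.symm⟩
            rw [ht₀, Finset.mem_singleton] at ht ht'
            rw [ht, ht']
          have hbij : Function.Bijective fun t => (w t).1 := Finite.injective_iff_bijective.1 hinj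
          obtain ⟨σ, ε, hε, hnf⟩ := map_word_eq_sign_smul_of_bijective_fst FS Lf w hbij
          -- the colour content of `w` is that of `ε`
          have hcnt : wordContent (colourWord w) 0 = (Finset.univ.filter fun c => ε c = 0).card := by
            change (Finset.univ.filter fun t => (w t).2 = 0).card = _
            rw [← Finset.card_image_of_injective (Finset.univ.filter fun t => (w t).2 = 0) hinj]
            congr 1
            ext c
            simp only [Finset.mem_image, Finset.mem_filter, Finset.mem_univ, true_and]
            constructor
            · rintro ⟨t, ht, rfl⟩; rw [hε t]; exact ht
            · intro hc
              obtain ⟨t, rfl⟩ := hbij.2 c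
              exact ⟨t, by rw [← hε t]; exact hc, rfl⟩
          refine Submodule.subset_span ⟨(((Equiv.Perm.sign σ : ℤˣ) : ℤ) : ℂ) • u, ε, p₁, q₁, hu.smul _, ?_, ?_⟩
          · rcases hpq with ⟨h1, h2, h3', -⟩ | ⟨h1, h2, h3', -⟩
            · exact Or.inl ⟨h1, h2, hcnt ▸ h3'⟩
            · exact Or.inr ⟨h1, h2, hcnt ▸ h3'⟩
          · rw [hnf]
            simp only [map_smul, LinearMap.smul_apply]
        · rw [hproj_kill K u w (fun s hs hK => hSK fun c => (hs c).symm.trans (hK c))]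
          exact Submodule.zero_mem _
      · have h0 : proj K 0 = 0 := by
          have h := hproj_smul K 0 0
          rwa [zero_smul, zero_smul] at h
        rw [h0]; exact Submodule.zero_mem _
      · intro x x' _ _ h h'
        rw [hproj_add]; exact Submodule.add_mem _ h h'
      · intro t x _ h
        rw [hproj_smul]; exact Submodule.smul_mem _ _ h
    -- (ii) a finite expansion of `z`
    obtain ⟨n, cf, gens, hzsum⟩ := Submodule.mem_span_set'.1 hzspan
    choose u ε p₁ q₁ hu hpq hgens using fun i => (gens i).2
    -- generator classes
    set g : Fin n → complexBetti (Y.prod (E.powSucc 2)).X (2 * 3) := fun i =>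
      cupProduct (show 3 + 3 = 2 * 3 by norm_num)
        (complexBetti.map (Motives.AbelianVariety.fst Y (E.powSucc 2)).hom.hom.hom 3 (u i))
        (complexBetti.map (Motives.AbelianVariety.snd Y (E.powSucc 2)).hom.hom.hom 3 (FS (fun c => Lf (c, ε i c)))) with hgdef
    have hzsum' : z = ∑ i, cf i • g i := by
      rw [← hzsum]
      exact Finset.sum_congr rfl fun i _ => by rw [hgens i]
    -- auxiliary: colour flip and signs
    let flip : Fin 2 → Fin 2 := fun r => if r = 0 then 1 else 0
    have hflip : ∀ r r' : Fin 2, r ≠ r' → r' = flip r := by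
      intro r r' h
      rcases fin2_eq_zero_or_one_cc r with rfl | rfl <;> rcases fin2_eq_zero_or_one_cc r' with rfl | rfl
      · exact absurd rfl h
      · rfl
      · rfl
      · exact absurd rfl h
    let τ : Fin 2 → ℂ := fun r => if r = 0 then 1 else -1
    -- the CM eigenvalues on `f₀ = ω`, `f₁ = ω̄`
    obtain ⟨μ, hμ, -, hμne⟩ := EllipticCurve.cm_eigenvalue χ hd' hχ hf0 (f.ne_zero 0) hgen
    have hμ1 : complexBetti.map χ.hom.hom.hom 1 (f 1) = starRingEnd ℂ μ • f 1 := by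
      rw [hf1]
      change singularCohomology.map ℂ ℂ _ 1 (conjClass _ 1 (f 0)) = _
      rw [← conjClass_map, ← conjClass_smul]
      exact congrArg _ hμ
    let lamχ : Fin 2 → ℂ := fun r => if r = 0 then μ else starRingEnd ℂ μ
    have hlamχ : ∀ r, complexBetti.map χ.hom.hom.hom 1 (f r) = lamχ r • f r := by
      intro r
      rcases fin2_eq_zero_or_one_cc r with rfl | rfl
      · exact hμ
      · exact hμ1
    have hlam1 : ∀ r, complexBetti.map (𝟙 E : E ⟶ E).hom.hom.hom 1 (f r) = (fun _ : Fin 2 => (1 : ℂ)) r • f r := by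
      intro r
      change complexBetti.map (𝟙 E.X) 1 (f r) = (1 : ℂ) • f r
      rw [complexBetti.map_id, one_smul]; rfl
    have hμμ : μ - starRingEnd ℂ μ ≠ 0 := sub_ne_zero.2 (Ne.symm hμne)
    -- (iii) the `(a,c)`-part of `z` for a pair of slots `a ≠ c` (third slot `b`)
    have hpair : ∀ a b c : Fin 3, a ≠ b → b ≠ c → a ≠ c →
        (∑ i, if ε i a ≠ ε i c then cf i • g i else 0) ∈ V := by
      intro a b c hab hbc hac
      -- the sorting permutation `(a, c, b)` and its sign
      have hv0 : (![a, c, b] : Fin 3 → Fin 3) 0 = a := rfl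
      have hv1 : (![a, c, b] : Fin 3 → Fin 3) 1 = c := rfl
      have hv2 : (![a, c, b] : Fin 3 → Fin 3) 2 = b := rfl
      have h3 : ∀ i : Fin 3, i = 0 ∨ i = 1 ∨ i = 2 := by intro i; fin_cases i <;> simp
      have hinjacb : Function.Injective (![a, c, b] : Fin 3 → Fin 3) := by
        intro i j hij
        rcases h3 i with rfl | rfl | rfl <;> rcases h3 j with rfl | rfl | rfl
        · rfl
        · exact absurd (hv0.symm.trans (hij.trans hv1)) hac
        · exact absurd (hv0.symm.trans (hij.trans hv2)) hab
        · exact absurd (hv1.symm.trans (hij.trans hv0)) (Ne.symm hac)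
        · rfl
        · exact absurd (hv1.symm.trans (hij.trans hv2)) (Ne.symm hbc)
        · exact absurd (hv2.symm.trans (hij.trans hv0)) (Ne.symm hab)
        · exact absurd (hv2.symm.trans (hij.trans hv1)) hbc
        · rfl
      set σ₀ : Equiv.Perm (Fin 3) := Equiv.ofBijective _ (Finite.injective_iff_bijective.1 hinjacb) with hσ₀
      set sgn : ℂ := (((Equiv.Perm.sign σ₀.symm : ℤˣ) : ℤ) : ℂ) with hsgn
      have hsgn1 : sgn * sgn = 1 := by
        rw [hsgn, ← Int.cast_mul, ← Units.val_mul, Int.units_mul_self, Units.val_one, Int.cast_one]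
      have hsgn0 : sgn ≠ 0 := fun h => by rw [h, mul_zero] at hsgn1; exact zero_ne_one hsgn1
      have hperm : ∀ X : Fin 3 → complexBetti (E.powSucc 2).X 1, FS X = sgn • FS ![X a, X c, X b] := by
        intro X
        have hX : X = (X ∘ σ₀) ∘ σ₀.symm := by
          funext t; simp only [Function.comp_apply, Equiv.apply_symm_apply]
        have hXσ : X ∘ σ₀ = ![X a, X c, X b] := by
          funext i
          rcases h3 i with rfl | rfl | rfl <;> rfl
        conv_lhs => rw [hX]
        rw [map_comp_perm_eq_intCast_sign_smul, hXσ]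
      -- sums over the three slots
      have hsum3 : ∀ φ : Fin 3 → ℕ, ∑ c', φ c' = φ a + φ c + φ b := by
        intro φ
        rw [← Equiv.sum_comp σ₀ φ, Fin.sum_univ_three]
        rfl
      have hcount : ∀ ε' : Fin 3 → Fin 2, (Finset.univ.filter fun c' => ε' c' = 0).card =
          (if ε' a = 0 then 1 else 0) + (if ε' c = 0 then 1 else 0) + (if ε' b = 0 then 1 else 0) := by
        intro ε'
        rw [Finset.card_filter, hsum3]
      -- the point class of slot `c` and the crosses of the pair `(a, c)`
      set DSc := cupProduct (rfl : 1 + 1 = 2) (Le (c, 0)) (Le (c, 1)) with hDSc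
      have hDScf : cupProduct (rfl : 1 + 1 = 2) (Lf (c, 0)) (Lf (c, 1)) = κ • DSc := by
        rw [hDSc, hLf, hLe, slotLetters_apply, slotLetters_apply, slotLetters_apply, slotLetters_apply,
          ← complexBetti.map_cupProduct, ← complexBetti.map_cupProduct, hκ, map_smul]
      have hτD : ∀ r : Fin 2, cupProduct (rfl : 1 + 1 = 2) (Lf (c, r)) (Lf (c, flip r)) = (τ r * κ) • DSc := by
        intro r
        rcases fin2_eq_zero_or_one_cc r with rfl | rfl
        · change cupProduct (rfl : 1 + 1 = 2) (Lf (c, 0)) (Lf (c, 1)) = ((1 : ℂ) * κ) • DSc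
          rw [one_mul, hDScf]
        · change cupProduct (rfl : 1 + 1 = 2) (Lf (c, 1)) (Lf (c, 0)) = ((-1 : ℂ) * κ) • DSc
          rw [cupProduct_gradedComm_holds ℂ _ rfl rfl (Lf (c, 1)) (Lf (c, 0)), mul_one, pow_one, hDScf, smul_smul]
      set DXc := complexBetti.map (Motives.AbelianVariety.snd Y (E.powSucc 2)).hom.hom.hom 2 DSc with hDXc
      set CX : Fin 2 → complexBetti (Y.prod (E.powSucc 2)).X 2 := fun r =>
        complexBetti.map (Motives.AbelianVariety.snd Y (E.powSucc 2)).hom.hom.hom 2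
          (cupProduct (rfl : 1 + 1 = 2) (Lf (a, r)) (Lf (c, flip r))) with hCX
      have hCXmem : ∀ r, CX r ∈ Submodule.span ℂ {b₁ : complexBetti (Y.prod (E.powSucc 2)).X 2 |
          IsRationalClass b₁ ∧ IsOfHodgeType (Y.prod (E.powSucc 2)).dim (Y.prod (E.powSucc 2)).X 2 1 1 b₁} := by
        intro r
        refine map_mem_span_rational_oneOne hXP hSs _ ?_
        rcases fin2_eq_zero_or_one_cc r with rfl | rfl
        · exact EllipticCurve.slotLetters_cross_mem_span_rational_oneOne_of_not_hodgeEndTrivial hE1 hT (powSlots E 2) f hf0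
            hgen hf1 a c
        · change cupProduct (rfl : 1 + 1 = 2) (Lf (a, 1)) (Lf (c, 0)) ∈ _
          rw [cupProduct_gradedComm_holds ℂ _ rfl rfl (Lf (a, 1)) (Lf (c, 0))]
          exact Submodule.smul_mem _ _
            (EllipticCurve.slotLetters_cross_mem_span_rational_oneOne_of_not_hodgeEndTrivial hE1 hT (powSlots E 2) f hf0
              hgen hf1 c a)
      -- the map `Φb` of slot `b`
      let Φb : (Fin 2 → complexBetti Y.X 3) → complexBetti (Y.prod (E.powSucc 2)).X (2 * 2) := fun γ =>
        ∑ j, cupProduct (show 3 + 1 = 2 * 2 by norm_num)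
          (complexBetti.map (Motives.AbelianVariety.fst Y (E.powSucc 2)).hom.hom.hom 3 (γ j))
          (complexBetti.map (Motives.AbelianVariety.snd Y (E.powSucc 2)).hom.hom.hom 1 (Le (b, j)))
      have hΦbadd : ∀ γ γ', Φb (γ + γ') = Φb γ + Φb γ' := by
        intro γ γ'
        simp only [Φb, Pi.add_apply, map_add, LinearMap.add_apply, Finset.sum_add_distrib]
      have hΦbsmul : ∀ (t : ℂ) γ, Φb (t • γ) = t • Φb γ := by
        intro t γ
        simp only [Φb, Pi.smul_apply, map_smul, LinearMap.smul_apply, Finset.smul_sum]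
      have hΦbsum : ∀ (γs : Fin n → Fin 2 → complexBetti Y.X 3), Φb (∑ i, γs i) = ∑ i, Φb (γs i) := by
        intro γs
        simp only [Φb, Finset.sum_apply, map_sum, LinearMap.sum_apply]
        rw [Finset.sum_comm]
      have hLfe : ∀ r : Fin 2, Lf (b, r) = ∑ j, e.repr (f r) j • Le (b, j) := fun r => by
        rw [hLf, hLe]
        exact slotLetters_baseChange (powSlots E 2) (fun j l => e.repr (f l) j) (fun l => by
          conv_lhs => rw [← e.sum_repr (f l)]) b r
      -- the `(2,2)`-factors `G i`
      set G : Fin n → complexBetti (Y.prod (E.powSucc 2)).X (2 * 2) := fun i =>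
        cupProduct (show 3 + 1 = 2 * 2 by norm_num)
          (complexBetti.map (Motives.AbelianVariety.fst Y (E.powSucc 2)).hom.hom.hom 3 (u i))
          (complexBetti.map (Motives.AbelianVariety.snd Y (E.powSucc 2)).hom.hom.hom 1 (Lf (b, ε i b))) with hGdef
      have hGΦ : ∀ i, G i = Φb (fun j => e.repr (f (ε i b)) j • u i) := by
        intro i
        simp only [hGdef, Φb]
        rw [hLfe (ε i b), map_sum, map_sum]
        refine Finset.sum_congr rfl fun j _ => ?_
        rw [map_smul, map_smul, LinearMap.map_smul, LinearMap.map_smul₂]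
      have hG22 : ∀ i, ε i a ≠ ε i c →
          IsOfHodgeType (Y.prod (E.powSucc 2)).dim (Y.prod (E.powSucc 2)).X (2 * 2) 2 2 (G i) := by
        intro i hne
        have hcnt := hcount (ε i)
        have hac1 : (if ε i a = 0 then 1 else 0) + (if ε i c = 0 then 1 else 0) = 1 := by
          rcases fin2_eq_zero_or_one_cc (ε i a) with h0 | h0 <;> rcases fin2_eq_zero_or_one_cc (ε i c) with h1 | h1
          · exact absurd (h0.trans h1.symm) hne
          · rw [h0, h1]; decide
          · rw [h0, h1]; decide
          · exact absurd (h0.trans h1.symm) hne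
        rcases fin2_eq_zero_or_one_cc (ε i b) with hb0 | hb0
        · have hL : IsOfHodgeType (Y.prod (E.powSucc 2)).dim (Y.prod (E.powSucc 2)).X 1 1 0
              (complexBetti.map (Motives.AbelianVariety.snd Y (E.powSucc 2)).hom.hom.hom 1 (Lf (b, ε i b))) :=
            (hLf0 (b, ε i b) hb0).map_of_isSmoothProjective hXP hSs _
          have hGt := hcup (show 3 + 1 = 2 * 2 by norm_num)
            ((hu i).map_of_isSmoothProjective hXP hYs (Motives.AbelianVariety.fst Y (E.powSucc 2)).hom.hom.hom) hL
          rw [hb0, if_pos rfl, hac1] at hcnt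
          rcases hpq i with ⟨h1, h2, h3'⟩ | ⟨h1, h2, h3'⟩
          · exact absurd (hcnt.symm.trans h3') (by decide)
          · rw [h1, h2] at hGt; exact hGt
        · have hL : IsOfHodgeType (Y.prod (E.powSucc 2)).dim (Y.prod (E.powSucc 2)).X 1 0 1
              (complexBetti.map (Motives.AbelianVariety.snd Y (E.powSucc 2)).hom.hom.hom 1 (Lf (b, ε i b))) :=
            (hLf1 (b, ε i b) hb0).map_of_isSmoothProjective hXP hSs _
          have hGt := hcup (show 3 + 1 = 2 * 2 by norm_num)
            ((hu i).map_of_isSmoothProjective hXP hYs (Motives.AbelianVariety.fst Y (E.powSucc 2)).hom.hom.hom) hL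
          rw [hb0, if_neg (by decide : (1 : Fin 2) ≠ 0), hac1] at hcnt
          rcases hpq i with ⟨h1, h2, h3'⟩ | ⟨h1, h2, h3'⟩
          · rw [h1, h2] at hGt; exact hGt
          · exact absurd (hcnt.symm.trans h3') (by decide)
      -- (I1) the generator in terms of `G i` and the cross
      have hI1 : ∀ i, ε i a ≠ ε i c →
          g i = sgn • cupProduct (show 2 * 2 + 2 * 1 = 2 * 3 by norm_num) (G i) (CX (ε i a)) := by
        intro i hne
        have hM : FS (fun c' => Lf (c', ε i c')) = sgn • cupProduct (show 2 + 1 = 3 by norm_num)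
            (cupProduct (rfl : 1 + 1 = 2) (Lf (a, ε i a)) (Lf (c, flip (ε i a)))) (Lf (b, ε i b)) := by
          rw [hperm, cupPowOneAlt_three', ← hflip _ _ hne]
        simp only [hgdef]
        rw [hM, map_smul, LinearMap.map_smul, cup_fst_three_snd_two_cup_one]
      -- (I2) the effect of a shear `x_a ↦ x_a + ψ(x_c)` on a generator
      have hI2 : ∀ (ψ : E ⟶ E) (lam : Fin 2 → ℂ), (∀ r, complexBetti.map ψ.hom.hom.hom 1 (f r) = lam r • f r) →
          ∀ (uψ : E.powSucc 2 ⟶ E.powSucc 2), uψ ≫ powSlots E 2 a = powSlots E 2 a + powSlots E 2 c ≫ ψ →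
          (∀ i', i' ≠ a → uψ ≫ powSlots E 2 i' = powSlots E 2 i') →
          ∀ i, complexBetti.map (Motives.AbelianVariety.prodMap (𝟙 Y) uψ).hom.hom.hom (2 * 3) (g i) - g i =
            if ε i a ≠ ε i c then (lam (ε i a) * sgn * (τ (ε i a) * κ)) •
              cupProduct (show 2 * 2 + 2 * 1 = 2 * 3 by norm_num) (G i) DXc else 0 := by
        intro ψ lam hlam uψ hua hui i
        simp only [hgdef]
        rw [map_prodMap_id_cupProduct_fst_snd, hFS, cupPowOneAlt_apply, Motives.complexBetti_map_cupPowOne]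
        -- the pulled-back letters
        have hletters : (fun c' => complexBetti.map uψ.hom.hom.hom 1 (Lf (c', ε i c'))) =
            Function.update (fun c' => Lf (c', ε i c')) a (Lf (a, ε i a) + lam (ε i a) • Lf (c, ε i a)) := by
          funext c'
          by_cases hc' : c' = a
          · rw [hc', Function.update_self, hLf, EllipticCurve.powThree_shear_slotLetters hua hui f a (ε i a), if_pos rfl, hlam,
              map_smul, slotLetters_apply, slotLetters_apply]
          · rw [Function.update_of_ne hc', hLf, EllipticCurve.powThree_shear_slotLetters hua hui f c' (ε i c'), if_neg hc']
        rw [hletters, MultilinearMap.map_update_add, Function.update_eq_self, MultilinearMap.map_update_smul,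
          ← cupPowOneAlt_apply, ← cupPowOneAlt_apply]
        -- the new word: slot `c` twice
        have hN : FS (Function.update (fun c' => Lf (c', ε i c')) a (Lf (c, ε i a))) =
            if ε i a ≠ ε i c then (sgn * (τ (ε i a) * κ)) • cupProduct (show 2 + 1 = 3 by norm_num) DSc (Lf (b, ε i b)) else 0 := by
          rw [hperm]
          have hua' : Function.update (fun c' => Lf (c', ε i c')) a (Lf (c, ε i a)) a = Lf (c, ε i a) := Function.update_self ..
          have huc' : Function.update (fun c' => Lf (c', ε i c')) a (Lf (c, ε i a)) c = Lf (c, ε i c) :=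
            Function.update_of_ne (Ne.symm hac) ..
          have hub' : Function.update (fun c' => Lf (c', ε i c')) a (Lf (c, ε i a)) b = Lf (b, ε i b) :=
            Function.update_of_ne (Ne.symm hab) ..
          rw [hua', huc', hub', cupPowOneAlt_three']
          split_ifs with hne
          · rw [hflip _ _ hne, hτD, LinearMap.map_smul₂, smul_smul]
          · push Not at hne
            rw [← hne, cup_self_deg_one, LinearMap.map_zero₂, smul_zero]
        rw [hN]
        split_ifs with hne
        · rw [map_add, LinearMap.map_add, add_sub_cancel_left, map_smul, map_smul, LinearMap.map_smul, LinearMap.map_smul,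
            cup_fst_three_snd_two_cup_one, smul_smul,
            show lam (ε i a) * (sgn * (τ (ε i a) * κ)) = lam (ε i a) * sgn * (τ (ε i a) * κ) by ring]
        · rw [smul_zero, add_zero, sub_self]
      -- the rational `(2,2)`-classes produced by the two shears
      have hshear : ∀ (ψ : E ⟶ E) (lam : Fin 2 → ℂ), (∀ r, complexBetti.map ψ.hom.hom.hom 1 (f r) = lam r • f r) →
          (∑ i, (if ε i a ≠ ε i c then cf i * (lam (ε i a) * sgn * (τ (ε i a) * κ)) else 0) • G i) ∈
            Submodule.span ℂ {a₁ : complexBetti (Y.prod (E.powSucc 2)).X (2 * 2) |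
              IsRationalClass a₁ ∧ IsOfHodgeType (Y.prod (E.powSucc 2)).dim (Y.prod (E.powSucc 2)).X (2 * 2) 2 2 a₁} := by
        intro ψ lam hlam
        obtain ⟨uψ, hua, hui⟩ := EllipticCurve.exists_powThree_shear a c ψ
        -- `Z = (𝟙 × uψ)^* z - z` is rational and equals `B ⌣ DXc`
        set B := ∑ i, (if ε i a ≠ ε i c then cf i * (lam (ε i a) * sgn * (τ (ε i a) * κ)) else 0) • G i with hB
        have hZ : complexBetti.map (Motives.AbelianVariety.prodMap (𝟙 Y) uψ).hom.hom.hom (2 * 3) z - z =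
            cupProduct (show 2 * 2 + 2 * 1 = 2 * 3 by norm_num) B DXc := by
          rw [hzsum', map_sum, ← Finset.sum_sub_distrib, hB, map_sum, LinearMap.sum_apply]
          refine Finset.sum_congr rfl fun i _ => ?_
          rw [map_smul, ← smul_sub, hI2 ψ lam hlam uψ hua hui i, LinearMap.map_smul₂]
          split_ifs with hne
          · rw [smul_smul]
          · rw [smul_zero, zero_smul]
        have hZQ : IsRationalClass (cupProduct (show 2 * 2 + 2 * 1 = 2 * 3 by norm_num) B DXc) := by
          rw [← hZ]; exact (hzQ.map _).sub hzQ
        -- `B = Φb γ`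
        set γ : Fin 2 → complexBetti Y.X 3 := ∑ i,
          (if ε i a ≠ ε i c then cf i * (lam (ε i a) * sgn * (τ (ε i a) * κ)) else 0) • fun j => e.repr (f (ε i b)) j • u i with hγ
        have hBΦ : B = Φb γ := by
          rw [hγ, hΦbsum, hB]
          refine Finset.sum_congr rfl fun i _ => ?_
          rw [hΦbsmul, ← hGΦ]
        have hγQ : ∀ j, IsRationalClass (γ j) := by
          refine isRationalClass_of_sum_cup_slot_cup_pointClass hE1 he (Ne.symm hbc) γ ?_
          have h := hZQ
          rw [hBΦ] at h
          exact h
        have hBQ : IsRationalClass B := by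
          rw [hBΦ]
          exact isRationalClass_sum _ _ fun j _ => ((hγQ j).map _).cup _ ((hLeQ (b, j)).map _)
        have hB22 : IsOfHodgeType (Y.prod (E.powSucc 2)).dim (Y.prod (E.powSucc 2)).X (2 * 2) 2 2 B := by
          rw [hB]
          refine IsOfHodgeType.sum hXP MX _ _ fun i _ => ?_
          split_ifs with hne
          · exact (hG22 i hne).smul _
          · rw [zero_smul]; exact IsOfHodgeType.zero MX _ _ _
        exact Submodule.subset_span ⟨hBQ, hB22⟩
      -- the two halves `P r` of the `(a,c)`-part
      set P : Fin 2 → complexBetti (Y.prod (E.powSucc 2)).X (2 * 2) := fun r =>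
        ∑ i, (if ε i a ≠ ε i c ∧ ε i a = r then cf i else 0) • G i with hP
      have hS1 := hshear (𝟙 E) (fun _ => 1) hlam1
      have hSχ := hshear χ lamχ hlamχ
      have hS1' : (∑ i, (if ε i a ≠ ε i c then cf i * ((fun _ : Fin 2 => (1 : ℂ)) (ε i a) * sgn * (τ (ε i a) * κ)) else 0) • G i) =
          (sgn * κ) • (P 0 - P 1) := by
        rw [hP, ← Finset.sum_sub_distrib, Finset.smul_sum]
        refine Finset.sum_congr rfl fun i _ => ?_
        rw [← sub_smul, smul_smul]
        congr 1
        have hτ0 : τ 0 = 1 := by simp [τ]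
        have hτ1 : τ 1 = -1 := by simp [τ]
        by_cases hne : ε i a ≠ ε i c
        · rcases fin2_eq_zero_or_one_cc (ε i a) with h0 | h0
          · rw [if_pos hne, if_pos ⟨hne, h0⟩, if_neg (fun h => absurd (h0.symm.trans h.2) (by decide)), h0, hτ0]; ring
          · rw [if_pos hne, if_neg (fun h => absurd (h0.symm.trans h.2) (by decide)), if_pos ⟨hne, h0⟩, h0, hτ1]; ring
        · rw [if_neg hne, if_neg (fun h => hne h.1), if_neg (fun h => hne h.1)]; ring
      have hSχ' : (∑ i, (if ε i a ≠ ε i c then cf i * (lamχ (ε i a) * sgn * (τ (ε i a) * κ)) else 0) • G i) =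
          (sgn * κ) • (μ • P 0 - starRingEnd ℂ μ • P 1) := by
        rw [hP, Finset.smul_sum, Finset.smul_sum, ← Finset.sum_sub_distrib, Finset.smul_sum]
        refine Finset.sum_congr rfl fun i _ => ?_
        rw [smul_smul, smul_smul, ← sub_smul, smul_smul]
        congr 1
        have hτ0 : τ 0 = 1 := by simp [τ]
        have hτ1 : τ 1 = -1 := by simp [τ]
        have hl0 : lamχ 0 = μ := by simp [lamχ]
        have hl1 : lamχ 1 = starRingEnd ℂ μ := by simp [lamχ]
        by_cases hne : ε i a ≠ ε i c
        · rcases fin2_eq_zero_or_one_cc (ε i a) with h0 | h0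
          · rw [if_pos hne, if_pos ⟨hne, h0⟩, if_neg (fun h => absurd (h0.symm.trans h.2) (by decide)), h0, hτ0, hl0]; ring
          · rw [if_pos hne, if_neg (fun h => absurd (h0.symm.trans h.2) (by decide)), if_pos ⟨hne, h0⟩, h0, hτ1, hl1]; ring
        · rw [if_neg hne, if_neg (fun h => hne h.1), if_neg (fun h => hne h.1)]; ring
      rw [hS1'] at hS1
      rw [hSχ'] at hSχ
      have hsk : sgn * κ ≠ 0 := mul_ne_zero hsgn0 hκ0
      have hP0 : P 0 ∈ Submodule.span ℂ {a₁ : complexBetti (Y.prod (E.powSucc 2)).X (2 * 2) |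
          IsRationalClass a₁ ∧ IsOfHodgeType (Y.prod (E.powSucc 2)).dim (Y.prod (E.powSucc 2)).X (2 * 2) 2 2 a₁} := by
        have h0 : ((sgn * κ) * (μ - starRingEnd ℂ μ)) • P 0 =
            (sgn * κ) • (μ • P 0 - starRingEnd ℂ μ • P 1) - starRingEnd ℂ μ • ((sgn * κ) • (P 0 - P 1)) := by
          module
        have h : P 0 = ((sgn * κ) * (μ - starRingEnd ℂ μ))⁻¹ •
            ((sgn * κ) • (μ • P 0 - starRingEnd ℂ μ • P 1) - starRingEnd ℂ μ • ((sgn * κ) • (P 0 - P 1))) := by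
          rw [← h0, smul_smul, inv_mul_cancel₀ (mul_ne_zero hsk hμμ), one_smul]
        rw [h]
        exact Submodule.smul_mem _ _ (Submodule.sub_mem _ hSχ (Submodule.smul_mem _ _ hS1))
      have hP1 : P 1 ∈ Submodule.span ℂ {a₁ : complexBetti (Y.prod (E.powSucc 2)).X (2 * 2) |
          IsRationalClass a₁ ∧ IsOfHodgeType (Y.prod (E.powSucc 2)).dim (Y.prod (E.powSucc 2)).X (2 * 2) 2 2 a₁} := by
        have h0 : ((sgn * κ) * (μ - starRingEnd ℂ μ)) • P 1 =
            (sgn * κ) • (μ • P 0 - starRingEnd ℂ μ • P 1) - μ • ((sgn * κ) • (P 0 - P 1)) := by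
          module
        have h : P 1 = ((sgn * κ) * (μ - starRingEnd ℂ μ))⁻¹ •
            ((sgn * κ) • (μ • P 0 - starRingEnd ℂ μ • P 1) - μ • ((sgn * κ) • (P 0 - P 1))) := by
          rw [← h0, smul_smul, inv_mul_cancel₀ (mul_ne_zero hsk hμμ), one_smul]
        rw [h]
        exact Submodule.smul_mem _ _ (Submodule.sub_mem _ hSχ (Submodule.smul_mem _ _ hS1))
      -- the `(a,c)`-part is `sgn · (P 0 ⌣ CX 0 + P 1 ⌣ CX 1)`
      have hsplit : (∑ i, if ε i a ≠ ε i c then cf i • g i else 0) =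
          sgn • (cupProduct (show 2 * 2 + 2 * 1 = 2 * 3 by norm_num) (P 0) (CX 0) +
            cupProduct (show 2 * 2 + 2 * 1 = 2 * 3 by norm_num) (P 1) (CX 1)) := by
        rw [hP, map_sum, map_sum, LinearMap.sum_apply, LinearMap.sum_apply, ← Finset.sum_add_distrib, Finset.smul_sum]
        refine Finset.sum_congr rfl fun i _ => ?_
        rw [LinearMap.map_smul₂, LinearMap.map_smul₂]
        by_cases hne : ε i a ≠ ε i c
        · rw [if_pos hne, hI1 i hne, smul_smul, mul_comm (cf i) sgn, ← smul_smul]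
          congr 1
          rcases fin2_eq_zero_or_one_cc (ε i a) with h0 | h0
          · rw [if_pos ⟨hne, h0⟩, if_neg (fun h => absurd (h0.symm.trans h.2) (by decide)), h0, zero_smul, add_zero]
          · rw [if_neg (fun h => absurd (h0.symm.trans h.2) (by decide)), if_pos ⟨hne, h0⟩, h0, zero_smul, zero_add]
        · rw [if_neg hne, if_neg (fun h => hne h.1), if_neg (fun h => hne h.1), zero_smul, zero_smul, add_zero, smul_zero]
      rw [hsplit]
      exact Submodule.smul_mem _ _ (Submodule.add_mem _ (hVcl _ hP0 _ (hCXmem 0)) (hVcl _ hP1 _ (hCXmem 1)))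
    -- (iv) `2 z` is the sum of the three `(a,c)`-parts
    have h2z : (2 : ℂ) • z = (∑ i, if ε i 0 ≠ ε i 1 then cf i • g i else 0) +
        (∑ i, if ε i 0 ≠ ε i 2 then cf i • g i else 0) + (∑ i, if ε i 1 ≠ ε i 2 then cf i • g i else 0) := by
      rw [hzsum', Finset.smul_sum, ← Finset.sum_add_distrib, ← Finset.sum_add_distrib]
      refine Finset.sum_congr rfl fun i _ => ?_
      have hcnt := hpq i
      have huniv : (Finset.univ : Finset (Fin 3)) = {0, 1, 2} := by decide
      rcases fin2_eq_zero_or_one_cc (ε i 0) with h0 | h0 <;> rcases fin2_eq_zero_or_one_cc (ε i 1) with h1 | h1 <;>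
        rcases fin2_eq_zero_or_one_cc (ε i 2) with h2 | h2 <;>
        simp only [h0, h1, h2, huniv, Finset.filter_insert, Finset.filter_singleton] at hcnt ⊢
      all_goals (simp only [ne_eq, not_true_eq_false, if_false, zero_ne_one, one_ne_zero, not_false_eq_true, if_true, add_zero,
            zero_add, two_smul])
      all_goals first | rfl | (exfalso; rcases hcnt with ⟨-, -, h⟩ | ⟨-, -, h⟩ <;> simp at h)
    have hz2 : z = (2 : ℂ)⁻¹ • ((2 : ℂ) • z) := by
      rw [smul_smul, inv_mul_cancel₀ (two_ne_zero), one_smul]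
    rw [hz2, h2z]
    exact Submodule.smul_mem _ _ (Submodule.add_mem _ (Submodule.add_mem _
      (hpair 0 2 1 (by decide) (by decide) (by decide)) (hpair 0 1 2 (by decide) (by decide) (by decide)))
      (hpair 1 0 2 (by decide) (by decide) (by decide)))
  -- (8) conclusion
  rw [hc_eq]
  refine Submodule.add_mem_sup hcBD ?_
  rw [hdecomp]
  exact Submodule.add_mem _ hKblock (Submodule.sum_mem _ fun p hp => hNblock p.1 p.2 (Finset.mem_filter.1 hp).2)

/-- **TABLE X row 21, codimension three, in the `(E × E) × E` spelling of the census**: every rational `(3,3)`-class on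
`T × ((E × E) × E)` lies in `D³ ⊔ span{a ⌣ b : a ∈ B², b ∈ B¹}` (`E.powSucc 2 = (E × E) × E` definitionally).
[cite: MoonenZarhin1999LowDim, Thm. 0.2 (1) with cases (a), (e) and §5 (5.3), (5.11)] -/
theorem mem_divisorClassesSpan_sup_span_cup_of_unitaryTwoOne_cmCurve_cube_codimThree (hY3 : Y.dim = 3)
    (hY2 : Module.finrank ℚ Y.endAlgebra = 2) (φY : Y ⟶ Y) {d : ℕ} (hd : 0 < d) (hφY : φY ≫ φY = -(d • 𝟙 Y))
    (hm1 : eigenMultiplicity Y φY (Complex.I * (Real.sqrt d : ℂ)) = 1 ∨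
      eigenMultiplicity Y φY (-(Complex.I * (Real.sqrt d : ℂ))) = 1)
    (hE1 : E.dim = 1) (χ : E ⟶ E) {d' : ℕ} (hd' : 0 < d') (hχ : χ ≫ χ = -(d' • 𝟙 E))
    {c : complexBetti (Y.prod ((E.prod E).prod E)).X (2 * 3)} (hcQ : IsRationalClass c)
    (hc : IsOfHodgeType (Y.prod ((E.prod E).prod E)).dim (Y.prod ((E.prod E).prod E)).X (2 * 3) 3 3 c) :
    c ∈ divisorClassesSpan (Y.prod ((E.prod E).prod E)).X (Y.prod ((E.prod E).prod E)).dim 3 ⊔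
      Submodule.span ℂ {w' : complexBetti (Y.prod ((E.prod E).prod E)).X (2 * 3) |
          ∃ (a : complexBetti (Y.prod ((E.prod E).prod E)).X (2 * 2)) (b : complexBetti (Y.prod ((E.prod E).prod E)).X (2 * 1)),
            IsRationalClass a ∧ IsOfHodgeType (Y.prod ((E.prod E).prod E)).dim (Y.prod ((E.prod E).prod E)).X (2 * 2) 2 2 a ∧
            IsRationalClass b ∧ IsOfHodgeType (Y.prod ((E.prod E).prod E)).dim (Y.prod ((E.prod E).prod E)).X (2 * 1) 1 1 b ∧
            w' = cupProduct (two_mul_add_two_mul 2 1) a b} :=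
  mem_divisorClassesSpan_sup_span_cup_of_unitaryTwoOne_cmCurve_powThree_codimThree hY3 hY2 φY hd hφY hm1 hE1 χ hd' hχ hcQ hc

end Main

end Literature.AlgebraicGeometry.HodgeTheory

end
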